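import Literature.Geometry.Riemannian.GradientShrinkerProofs
import Literature.Geometry.Lorentzian.CoordFisherDissipation
import Literature.Geometry.Riemannian.RicciFlowScalarCurvatureEvolution
import Literature.Geometry.Riemannian.ConjugateHeatConservation
import Literature.Geometry.Lorentzian.EndChartIntegral
import Mathlib.Analysis.Calculus.ParametricIntegral
import HarnessLib

/-!
# The Bakry–Émery strategy on a closed weighted manifold: from the weighted heat flow to the
# logarithmic Sobolev inequality, and Carrillo–Ni's Cor. 4.1 from the heat flow

Proof file towards `carrilloNi_muEntropy_eq_log_shrinkerDensity_holds` (`GradientShrinker.lean`,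
J. A. Carrillo, L. Ni, Comm. Anal. Geom. 17 (2009) 721–753 = arXiv:0806.2417, Cor. 4.1, closed
case). `GradientShrinkerProofs.lean` reduced the named fact to the logarithmic Sobolev inequality of
Bakry–Émery on closed weighted manifolds (`carrilloNi_muEntropy_eq_log_shrinkerDensity_of_bakryEmery`,
its hypothesis `hBE`; Carrillo–Ni's Thm. 3.1, after Bakry–Émery 1985 / Villani). Carrillo–Ni, §3,
pp. 7–8 recall the "Bakry–Émery strategy" for that inequality: along the Fokker–Planck (weighted
heat) flow the relative entropy `H_V` dissipates at the rate of the Fisher information,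
`dH/dt = −I` ((3.2)), and `dI/dt = ∫ (−2ξ_{ij}² − 2(R_{ij} + V_{ij})ξ_iξ_j)ρ ≤ −2K I` (display on
p. 8, from the Bochner formula), so that `H(0) = ∫₀^∞ I ≤ I(0)/2K`. This file PROVES that strategy,
for ANY model space, along ONE given trajectory of the weighted heat flow, and concludes:

* `carrilloNi_muEntropy_eq_log_shrinkerDensity_of_heatFlow` — **the named fact follows from the
  existence and long-time behaviour of the weighted heat flow on closed weighted manifolds**
  (hypothesis `hHeat`: for `g` Riemannian on a closed connected manifold, `V` smooth with
  `∫ e^{-V} dV_g = 1`, and `h₀` smooth positive, there is `u` smooth on `M × [0, ∞)`, positive,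
  `u(0) = h₀`, `∂ₜu = Δ_g u − g⁻¹(dV, du)`, `u(t, ·) → ∫ h₀ e^{-V} dV_g` uniformly as `t → ∞` — the
  weighted heat semigroup, e.g. A. Grigor'yan, *Heat kernel and analysis on manifolds* (2009),
  Ch. 7 and the spectral expansion on compact weighted manifolds; linear parabolic theory,
  which the tree does not have yet). This is the one remaining input of the discharge.

## Contents (everything proved; no definitions, no statements of `Prop` type)

* §G1 `integral_mul_weightedLaplacian`, `integral_weightedLaplacian_eq_zero`,
  `integral_mul_weightedLaplacian_comm` — the weighted Green identities
  `∫ a (Lb) e^{-V} dV = −∫ g⁻¹(da, db) e^{-V} dV`, `L = Δ_g − g⁻¹(dV, d·)` (symmetry of `L` for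
  `dm = e^{-V} dV_g`; from Green's identity for any model, `integral_mul_dalembertian_riemVolume`).
* §Chart `innerDual_chartInv_eq`, `gradSq_chartInv_eq`, `dalembertian_chartInv_eq`,
  `bakryEmery_chartInv_le`, `normSqAt_hessAt_chartRep_nonneg`, `contMDiff_gradSq`,
  `contMDiff_dalembertian` — reading `|∇F|²`, `ΔF`, `Ric + Hess V ≥ K g` and `|Hess F|² ≥ 0` in
  the chart at a point (`chartInv`/`chartPullback`/`chartRep` of `RicciDeTurckNaturality.lean`,
  `RicciDeTurckChartFamily.lean`; `OpensChart.*_eq_*At` of `ChartMetricCoord.lean`).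
* `fisher_pointwise_le` — **the pointwise dissipation inequality**
  `∂ₜ|∇f|² ≤ L|∇f|² − 2 g⁻¹(df, d|∇f|²) − 2K|∇f|²` on `M` for `f` smooth on `M × S` solving
  `∂ₜf = Lf − |∇f|²` (the equation of `−log u`, `∂ₜu = Lu`), under `Ric + Hess V ≥ K g`: the
  coordinate identity `MetricCoord.IsMetricOn.fisher_identity` (`CoordFisherDissipation.lean`:
  weighted Bochner formula) transported through the chart, dropping `|Hess f|² ≥ 0`.
* `contMDiffOn_innerDual_family`, `contMDiffOn_gradSq_family` (joint smoothness on `M × S`),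
  `hasDerivAt_integral_of_continuousOn_prod`, `continuousOn_integral_of_continuousOn_prod`
  (Leibniz rule / continuity of `t ↦ ∫_M F(t, ·) dμ` on a compact space).
* `integral_derivWithin_fisher_le` — `∫ ∂ₜ(|∇f|²e^{-f}) dm ≤ −2K ∫ |∇f|² e^{-f} dm` (integration of
  the pointwise inequality; the `L`- and gradient terms cancel by the symmetry of `L`,
  `L(e^{-f}) = e^{-f}(|∇f|² − Lf)`, `d(e^{-f}) = −e^{-f}df`) — Carrillo–Ni p. 8.
* `fisher_le_exp_mul` — `I(T) ≤ e^{−2KT} I(0)`; `hasDerivAt_entropy` — `dH/dt = −I` ((3.2));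
  `entropy_le_fisher_div` — `H(0) ≤ I(0)/2K` provided `H(T) → 0`.
* `negLog_heat_equation` (`f = −log u` solves `∂ₜf = Lf − |∇f|²` when `∂ₜu = Lu`, `u > 0`),
  `tendsto_entropy_of_tendstoUniformly`, **`logSobolev_of_heatFlow`** — the Bakry–Émery inequality
  `∫ φ e^φ dm ≤ (1/2K) ∫ |∇φ|² e^φ dm` (smooth `φ`, `∫ e^φ dm = 1`) from the heat flow started at
  `e^φ` — and `carrilloNi_muEntropy_eq_log_shrinkerDensity_of_heatFlow`.

## References

* [CarrilloNi2009] J. A. Carrillo, L. Ni, Comm. Anal. Geom. 17 (2009) 721–753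
  (arXiv:0806.2417): §3, (3.1)–(3.4), Thm. 3.1 and the computation of `d/dt I_V` (p. 8); §4,
  Cor. 4.1 (read: arXiv text pp. 5–9).
* D. Bakry, M. Émery, *Diffusions hypercontractives*, Sém. Probab. XIX, LNM 1123 (1985) 177–206
  (the `Γ₂`-criterion and this semigroup argument). [BakryEmery1985]
* A. Grigor'yan, *Heat kernel and analysis on manifolds*, AMS/IP Stud. Adv. Math. 47 (2009),
  Ch. 7 (the heat semigroup of a weighted manifold), for the remaining hypothesis `hHeat`.
* [Topping2006] P. Topping, *Lectures on the Ricci flow* (2006), proof of Prop. 8.2.6 (Bochner).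
* [ONeill1983] B. O'Neill, *Semi-Riemannian geometry* (1983), Ch. 3, Prop. 3.59 (naturality).
-/

noncomputable section

open Bundle Set Function Module Filter Manifold MeasureTheory
open scoped ContDiff Topology

namespace Literature.Geometry.Riemannian

open Lorentzian Lorentzian.PseudoRiemannianMetric

universe u

/-! ### Pointwise: the inverse metric on covectors is bilinear; `d(a e^{-V})` -/

section Pointwise

variable {E : Type*} [NormedAddCommGroup E] [NormedSpace ℝ E] [FiniteDimensional ℝ E]
  {H : Type*} [TopologicalSpace H] {I : ModelWithCorners ℝ E H} {M : Type*} [TopologicalSpace M]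
  [ChartedSpace H M] [IsManifold I ∞ M]
  (g : PseudoRiemannianMetric I ∞ E (TangentSpace I : M → Type _))

/-- `g⁻¹(α + α', β) = g⁻¹(α, β) + g⁻¹(α', β)`. [folklore] -/
theorem _root_.Literature.Geometry.Lorentzian.PseudoRiemannianMetric.innerDual_add_left (x : M)
    (α α' β : Module.Dual ℝ (TangentSpace I x)) :
    g.innerDual x (α + α') β = g.innerDual x α β + g.innerDual x α' β := by
  simp only [PseudoRiemannianMetric.innerDual, LinearMap.add_apply]

/-- `g⁻¹(c α, β) = c g⁻¹(α, β)`. [folklore] -/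
theorem _root_.Literature.Geometry.Lorentzian.PseudoRiemannianMetric.innerDual_smul_left (x : M)
    (c : ℝ) (α β : Module.Dual ℝ (TangentSpace I x)) :
    g.innerDual x (c • α) β = c * g.innerDual x α β := by
  simp only [PseudoRiemannianMetric.innerDual, LinearMap.smul_apply, smul_eq_mul]

/-- `g⁻¹(α, c β) = c g⁻¹(α, β)`. [folklore] -/
theorem _root_.Literature.Geometry.Lorentzian.PseudoRiemannianMetric.innerDual_smul_right (x : M)
    (c : ℝ) (α β : Module.Dual ℝ (TangentSpace I x)) :
    g.innerDual x α (c • β) = c * g.innerDual x α β := by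
  rw [g.innerDual_comm x α (c • β), g.innerDual_smul_left, g.innerDual_comm]

/-- `g⁻¹(α − α', β) = g⁻¹(α, β) − g⁻¹(α', β)`. [folklore] -/
theorem _root_.Literature.Geometry.Lorentzian.PseudoRiemannianMetric.innerDual_sub_left (x : M)
    (α α' β : Module.Dual ℝ (TangentSpace I x)) :
    g.innerDual x (α - α') β = g.innerDual x α β - g.innerDual x α' β := by
  simp only [PseudoRiemannianMetric.innerDual, LinearMap.sub_apply]

omit [IsManifold I ∞ M] [FiniteDimensional ℝ E] in
/-- **The differential of `a e^{-V}`**: `d(a e^{-V}) = e^{-V} da − a e^{-V} dV` (as linear maps),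
for `a, V` differentiable at the point. [folklore] -/
theorem mvfderiv_mul_exp_neg_toLinearMap {a V : M → ℝ} {x : M}
    (ha : MDifferentiableAt I 𝓘(ℝ, ℝ) a x) (hV : MDifferentiableAt I 𝓘(ℝ, ℝ) V x) :
    (mvfderiv I (fun y ↦ a y * Real.exp (-V y)) x : TangentSpace I x →ₗ[ℝ] ℝ) =
      Real.exp (-V x) • (mvfderiv I a x : TangentSpace I x →ₗ[ℝ] ℝ)
        - (a x * Real.exp (-V x)) • (mvfderiv I V x : TangentSpace I x →ₗ[ℝ] ℝ) := by
  have hE : MDifferentiableAt I 𝓘(ℝ, ℝ) (fun y ↦ Real.exp (-V y)) x :=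
    ((Real.differentiable_exp.comp differentiable_neg).differentiableAt
      (x := V x)).comp_mdifferentiableAt hV
  have hd : ∀ v, mvfderiv I (fun y ↦ Real.exp (-V y)) x v = -Real.exp (-V x) * mvfderiv I V x v := by
    intro v
    have h1 : HasDerivAt (fun t : ℝ ↦ Real.exp (-t)) (-Real.exp (-V x)) (V x) := by
      simpa using (hasDerivAt_neg (V x)).exp
    exact mvfderiv_real_comp_apply (I := I) h1 hV v
  ext v
  have hmul := mvfderiv_fun_mul ha hE
  simp only [ContinuousLinearMap.coe_coe, LinearMap.sub_apply, LinearMap.smul_apply, smul_eq_mul]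
  rw [hmul]
  simp only [add_apply, smul_apply, smul_eq_mul, hd v]
  ring

end Pointwise

/-! ### The weighted Green identities on a closed manifold (any model space) -/

section WeightedGreen

variable {E : Type*} [NormedAddCommGroup E] [NormedSpace ℝ E] [FiniteDimensional ℝ E]
  {H : Type*} [TopologicalSpace H] {I : ModelWithCorners ℝ E H} [I.Boundaryless]
  {M : Type*} [TopologicalSpace M] [ChartedSpace H M] [IsManifold I ∞ M]
  [CompactSpace M] [T3Space M] [MeasurableSpace M] [BorelSpace M]
  (g : PseudoRiemannianMetric I ∞ E (TangentSpace I : M → Type _)) [g.HasLeviCivita]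

/-- **Weighted Green identity `∫ a (L b) dm = −∫ g⁻¹(da, db) dm`** on a closed Riemannian manifold
(any model space), for the weighted measure `dm = e^{-V} dV_g` and the weighted Laplacian
`L b = Δ_g b − g⁻¹(dV, db)`, `a ∈ C¹`, `b ∈ C²`, `V ∈ C¹`: Green's first identity
`∫ (a e^{-V}) Δb dV = −∫ g⁻¹(d(a e^{-V}), db) dV` (`integral_mul_dalembertian_riemVolume`) with
`d(a e^{-V}) = e^{-V} da − a e^{-V} dV`. This is the symmetry / integration by parts formula
`∫ f Lg dμ = −∫ Γ(f, g) dμ` of the Markov triple `(M, e^{-V}dV, Γ)` (Bakry–Gentil–Ledoux), the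
integration by parts used throughout Carrillo–Ni's §3–§4 (e.g. `∫⟨∇f, ∇ρ⟩ = −∫ ρ Δf` on p. 9).
[cite: CarrilloNi2009, §3 (3.2) and §4 (integration by parts)] -/
theorem integral_mul_weightedLaplacian (hg : g.IsRiemannian) {a b V : M → ℝ}
    (ha : ContMDiff I 𝓘(ℝ, ℝ) 1 a) (hb : ContMDiff I 𝓘(ℝ, ℝ) 2 b) (hV : ContMDiff I 𝓘(ℝ, ℝ) 1 V) :
    ∫ x, a x * (g.dalembertian b x
        - g.innerDual x (mvfderiv I V x : TangentSpace I x →ₗ[ℝ] ℝ)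
            (mvfderiv I b x : TangentSpace I x →ₗ[ℝ] ℝ)) * Real.exp (-V x) ∂g.riemVolume =
      -∫ x, g.innerDual x (mvfderiv I a x : TangentSpace I x →ₗ[ℝ] ℝ)
          (mvfderiv I b x : TangentSpace I x →ₗ[ℝ] ℝ) * Real.exp (-V x) ∂g.riemVolume := by
  -- Green's first identity for `u = a e^{-V}` and `f = b`
  have hexp : ContMDiff I 𝓘(ℝ, ℝ) 1 (fun y ↦ Real.exp (-V y)) :=
    ((Real.contDiff_exp.comp contDiff_neg).of_le le_top).comp_contMDiff hV
  have hu : ContMDiff I 𝓘(ℝ, ℝ) 1 (fun y ↦ a y * Real.exp (-V y)) := ha.mul hexp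
  have hG := integral_mul_dalembertian_riemVolume g hg hu hb
  have hb1 : ContMDiff I 𝓘(ℝ, ℝ) 1 b := hb.of_le (by norm_num)
  -- the integrand of the right-hand side of Green, pointwise
  have hpt : ∀ x, g.innerDual x (mvfderiv I (fun y ↦ a y * Real.exp (-V y)) x :
        TangentSpace I x →ₗ[ℝ] ℝ) (mvfderiv I b x : TangentSpace I x →ₗ[ℝ] ℝ) =
      g.innerDual x (mvfderiv I a x : TangentSpace I x →ₗ[ℝ] ℝ)
          (mvfderiv I b x : TangentSpace I x →ₗ[ℝ] ℝ) * Real.exp (-V x)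
        - a x * g.innerDual x (mvfderiv I V x : TangentSpace I x →ₗ[ℝ] ℝ)
            (mvfderiv I b x : TangentSpace I x →ₗ[ℝ] ℝ) * Real.exp (-V x) := by
    intro x
    rw [mvfderiv_mul_exp_neg_toLinearMap (ha.mdifferentiableAt one_ne_zero)
      (hV.mdifferentiableAt one_ne_zero), g.innerDual_sub_left, g.innerDual_smul_left,
      g.innerDual_smul_left]
    ring
  -- continuity, integrability
  have hΔc : Continuous (g.dalembertian b) := continuous_dalembertian g hb
  have hIVc : Continuous fun x ↦ g.innerDual x (mvfderiv I V x : TangentSpace I x →ₗ[ℝ] ℝ)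
      (mvfderiv I b x : TangentSpace I x →ₗ[ℝ] ℝ) := continuous_innerDual_mvfderiv g hV hb1
  have hIac : Continuous fun x ↦ g.innerDual x (mvfderiv I a x : TangentSpace I x →ₗ[ℝ] ℝ)
      (mvfderiv I b x : TangentSpace I x →ₗ[ℝ] ℝ) := continuous_innerDual_mvfderiv g ha hb1
  have hec : Continuous fun x ↦ Real.exp (-V x) := hexp.continuous
  have i1 : Integrable (fun x ↦ (a x * Real.exp (-V x)) * g.dalembertian b x) g.riemVolume :=
    g.integrable_of_continuous ((ha.continuous.mul hec).mul hΔc)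
  have i2 : Integrable (fun x ↦ a x * g.innerDual x (mvfderiv I V x : TangentSpace I x →ₗ[ℝ] ℝ)
      (mvfderiv I b x : TangentSpace I x →ₗ[ℝ] ℝ) * Real.exp (-V x)) g.riemVolume :=
    g.integrable_of_continuous ((ha.continuous.mul hIVc).mul hec)
  have i3 : Integrable (fun x ↦ g.innerDual x (mvfderiv I a x : TangentSpace I x →ₗ[ℝ] ℝ)
      (mvfderiv I b x : TangentSpace I x →ₗ[ℝ] ℝ) * Real.exp (-V x)) g.riemVolume :=
    g.integrable_of_continuous (hIac.mul hec)
  -- split the integrals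
  have s1 : ∫ x, a x * (g.dalembertian b x
        - g.innerDual x (mvfderiv I V x : TangentSpace I x →ₗ[ℝ] ℝ)
            (mvfderiv I b x : TangentSpace I x →ₗ[ℝ] ℝ)) * Real.exp (-V x) ∂g.riemVolume =
      ∫ x, ((a x * Real.exp (-V x)) * g.dalembertian b x
        - a x * g.innerDual x (mvfderiv I V x : TangentSpace I x →ₗ[ℝ] ℝ)
            (mvfderiv I b x : TangentSpace I x →ₗ[ℝ] ℝ) * Real.exp (-V x)) ∂g.riemVolume :=
    integral_congr_ae (Eventually.of_forall fun x ↦ by ring)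
  have s2 : ∫ x, ((a x * Real.exp (-V x)) * g.dalembertian b x
        - a x * g.innerDual x (mvfderiv I V x : TangentSpace I x →ₗ[ℝ] ℝ)
            (mvfderiv I b x : TangentSpace I x →ₗ[ℝ] ℝ) * Real.exp (-V x)) ∂g.riemVolume =
      ∫ x, (a x * Real.exp (-V x)) * g.dalembertian b x ∂g.riemVolume
      - ∫ x, a x * g.innerDual x (mvfderiv I V x : TangentSpace I x →ₗ[ℝ] ℝ)
            (mvfderiv I b x : TangentSpace I x →ₗ[ℝ] ℝ) * Real.exp (-V x) ∂g.riemVolume :=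
    integral_sub i1 i2
  have s3 : ∫ x, g.innerDual x (mvfderiv I (fun y ↦ a y * Real.exp (-V y)) x :
        TangentSpace I x →ₗ[ℝ] ℝ) (mvfderiv I b x : TangentSpace I x →ₗ[ℝ] ℝ) ∂g.riemVolume =
      ∫ x, (g.innerDual x (mvfderiv I a x : TangentSpace I x →ₗ[ℝ] ℝ)
          (mvfderiv I b x : TangentSpace I x →ₗ[ℝ] ℝ) * Real.exp (-V x)
        - a x * g.innerDual x (mvfderiv I V x : TangentSpace I x →ₗ[ℝ] ℝ)
            (mvfderiv I b x : TangentSpace I x →ₗ[ℝ] ℝ) * Real.exp (-V x)) ∂g.riemVolume :=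
    integral_congr_ae (Eventually.of_forall hpt)
  have s4 : ∫ x, (g.innerDual x (mvfderiv I a x : TangentSpace I x →ₗ[ℝ] ℝ)
          (mvfderiv I b x : TangentSpace I x →ₗ[ℝ] ℝ) * Real.exp (-V x)
        - a x * g.innerDual x (mvfderiv I V x : TangentSpace I x →ₗ[ℝ] ℝ)
            (mvfderiv I b x : TangentSpace I x →ₗ[ℝ] ℝ) * Real.exp (-V x)) ∂g.riemVolume =
      ∫ x, g.innerDual x (mvfderiv I a x : TangentSpace I x →ₗ[ℝ] ℝ)
          (mvfderiv I b x : TangentSpace I x →ₗ[ℝ] ℝ) * Real.exp (-V x) ∂g.riemVolume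
      - ∫ x, a x * g.innerDual x (mvfderiv I V x : TangentSpace I x →ₗ[ℝ] ℝ)
            (mvfderiv I b x : TangentSpace I x →ₗ[ℝ] ℝ) * Real.exp (-V x) ∂g.riemVolume :=
    integral_sub i3 i2
  linarith [hG, s1, s2, s3, s4]

/-- **`∫ (L b) dm = 0`**: `∫ (Δ_g b − g⁻¹(dV, db)) e^{-V} dV_g = 0` on a closed Riemannian
manifold (`integral_mul_weightedLaplacian` with `a = 1`, `da = 0`). Conservation of mass of the
Fokker–Planck flow (Carrillo–Ni, §3). [cite: CarrilloNi2009, §3 (3.1)–(3.2)] -/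
theorem integral_weightedLaplacian_eq_zero (hg : g.IsRiemannian) {b V : M → ℝ}
    (hb : ContMDiff I 𝓘(ℝ, ℝ) 2 b) (hV : ContMDiff I 𝓘(ℝ, ℝ) 1 V) :
    ∫ x, (g.dalembertian b x
        - g.innerDual x (mvfderiv I V x : TangentSpace I x →ₗ[ℝ] ℝ)
            (mvfderiv I b x : TangentSpace I x →ₗ[ℝ] ℝ)) * Real.exp (-V x) ∂g.riemVolume = 0 := by
  have h := integral_mul_weightedLaplacian g hg (a := fun _ ↦ (1 : ℝ)) contMDiff_const hb hV
  have h0 : ∀ x, (mvfderiv I (fun _ : M ↦ (1 : ℝ)) x : TangentSpace I x →ₗ[ℝ] ℝ) = 0 := fun x ↦ by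
    rw [mvfderiv_const]; rfl
  simp only [one_mul, h0] at h
  simpa [PseudoRiemannianMetric.innerDual] using h

/-- **`L` is symmetric for `dm = e^{-V} dV_g`**: `∫ a (L b) dm = ∫ b (L a) dm` for `a, b ∈ C²`
(both equal `−∫ g⁻¹(da, db) dm`). [cite: CarrilloNi2009, §3] -/
theorem integral_mul_weightedLaplacian_comm (hg : g.IsRiemannian) {a b V : M → ℝ}
    (ha : ContMDiff I 𝓘(ℝ, ℝ) 2 a) (hb : ContMDiff I 𝓘(ℝ, ℝ) 2 b) (hV : ContMDiff I 𝓘(ℝ, ℝ) 1 V) :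
    ∫ x, a x * (g.dalembertian b x
        - g.innerDual x (mvfderiv I V x : TangentSpace I x →ₗ[ℝ] ℝ)
            (mvfderiv I b x : TangentSpace I x →ₗ[ℝ] ℝ)) * Real.exp (-V x) ∂g.riemVolume =
      ∫ x, b x * (g.dalembertian a x
        - g.innerDual x (mvfderiv I V x : TangentSpace I x →ₗ[ℝ] ℝ)
            (mvfderiv I a x : TangentSpace I x →ₗ[ℝ] ℝ)) * Real.exp (-V x) ∂g.riemVolume := by
  rw [integral_mul_weightedLaplacian g hg (ha.of_le (by norm_num)) hb hV,
    integral_mul_weightedLaplacian g hg (hb.of_le (by norm_num)) ha hV]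
  congr 1
  refine integral_congr_ae (Eventually.of_forall fun x ↦ ?_)
  dsimp only
  rw [g.innerDual_comm]

end WeightedGreen

end Literature.Geometry.Riemannian

/-! ## PART 2 — manifold level: the pointwise dissipation inequality read through a chart -/

open Bundle Set Function Filter
open scoped Manifold ContDiff Topology

namespace Literature.Geometry.Lorentzian



end Literature.Geometry.Lorentzian

namespace Literature.Geometry.Riemannian

open Lorentzian Lorentzian.PseudoRiemannianMetric

/-! ### Reading `g⁻¹(dF₁, dF₂)`, `|∇F|²`, `Δ F` and the Bakry–Émery tensor in the chart at `x₀` -/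

section ChartBridge

variable {E : Type*} [NormedAddCommGroup E] [NormedSpace ℝ E] [FiniteDimensional ℝ E]
  {H : Type*} [TopologicalSpace H] {I : ModelWithCorners ℝ E H} [I.Boundaryless]
  {M : Type*} [TopologicalSpace M] [ChartedSpace H M] [IsManifold I ∞ M]
  (g : PseudoRiemannianMetric I ∞ E (TangentSpace I : M → Type _))

omit [FiniteDimensional ℝ E] in
/-- The inverse extended chart is differentiable (model `𝓘(ℝ, E)`) at the points of the target, so
the representative `F ∘ (extChartAt I x₀)⁻¹` of a function differentiable at `Φ u` is
differentiable at `u`. [folklore] -/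
theorem differentiableAt_comp_extChartAt_symm (x₀ : M) (u : chartTarget I x₀) {F : M → ℝ}
    (hF : MDifferentiableAt I 𝓘(ℝ, ℝ) F (chartInv I x₀ u)) :
    DifferentiableAt ℝ (F ∘ (extChartAt I x₀).symm) (u : E) := by
  have hsymm : MDifferentiableAt 𝓘(ℝ, E) I (extChartAt I x₀).symm (u : E) := by
    have h := mdifferentiableWithinAt_extChartAt_symm (I := I) (coe_mem_target x₀ u)
    rwa [ModelWithCorners.Boundaryless.range_eq_univ, mdifferentiableWithinAt_univ] at h
  have hc : MDifferentiableAt 𝓘(ℝ, E) 𝓘(ℝ, ℝ) (F ∘ (extChartAt I x₀).symm) (u : E) :=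
    hF.comp (u : E) hsymm
  exact mdifferentiableAt_iff_differentiableAt.1 hc

omit [FiniteDimensional ℝ E] in
/-- The manifold differential of `F ∘ Φ` on the chart target is the Fréchet differential of the
representative `F ∘ (extChartAt I x₀)⁻¹` (`OpensChart.mvfderiv_eq`). [folklore] -/
theorem mvfderiv_comp_chartInv_toLinearMap (x₀ : M) (u : chartTarget I x₀) {F : M → ℝ}
    (hF : MDifferentiableAt I 𝓘(ℝ, ℝ) F (chartInv I x₀ u)) :
    (mvfderiv 𝓘(ℝ, E) (F ∘ chartInv I x₀) u : TangentSpace 𝓘(ℝ, E) u →ₗ[ℝ] ℝ) =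
      ((fderiv ℝ (F ∘ (extChartAt I x₀).symm) (u : E) : E →L[ℝ] ℝ) : E →ₗ[ℝ] ℝ) := by
  ext v
  exact Lorentzian.OpensChart.mvfderiv_eq u (F ∘ chartInv I x₀) (F ∘ (extChartAt I x₀).symm)
    (fun _ ↦ rfl) (differentiableAt_comp_extChartAt_symm x₀ u hF) v

/-- **`g⁻¹(dF₁, dF₂)` read in the chart**: for functions `F₁, F₂` differentiable at `Φ u`,
`g⁻¹(dF₁, dF₂)(Φ u) = DF̂₁(u)(♯_{G(u)} DF̂₂(u))` with `F̂ᵢ = Fᵢ ∘ (extChartAt I x₀)⁻¹` and `G` the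
chart components of `g` (`innerDual_mvfderiv_comp` of `EndChartIntegral.lean`, `OpensChart.mvfderiv_eq`,
`OpensChart.sharp_eq_sharpAt`). [cite: ONeill1983, Ch. 3, Prop. 3.59 and p. 60] -/
theorem innerDual_chartInv_eq (x₀ : M) (u : chartTarget I x₀) {F₁ F₂ : M → ℝ}
    (h₁ : MDifferentiableAt I 𝓘(ℝ, ℝ) F₁ (chartInv I x₀ u))
    (h₂ : MDifferentiableAt I 𝓘(ℝ, ℝ) F₂ (chartInv I x₀ u)) :
    g.innerDual (chartInv I x₀ u)
        (mvfderiv I F₁ (chartInv I x₀ u) : TangentSpace I (chartInv I x₀ u) →ₗ[ℝ] ℝ)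
        (mvfderiv I F₂ (chartInv I x₀ u) : TangentSpace I (chartInv I x₀ u) →ₗ[ℝ] ℝ) =
      fderiv ℝ (F₁ ∘ (extChartAt I x₀).symm) u
        (MetricCoord.sharpAt (chartRep I (fun _ ↦ g) x₀ 0) u
          (fderiv ℝ (F₂ ∘ (extChartAt I x₀).symm) u)) := by
  have hG := val_chartPullback_eq_chartRep (fun _ : ℝ ↦ g) x₀ 0
  rw [← g.innerDual_mvfderiv_comp contMDiff_pullbackBilin_holds (contMDiff_chartInv x₀)
    (injective_mfderiv_chartInv x₀) rfl u h₁ h₂]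
  change (mvfderiv 𝓘(ℝ, E) (F₁ ∘ chartInv I x₀) u : TangentSpace 𝓘(ℝ, E) u →ₗ[ℝ] ℝ)
      ((chartPullback I g x₀).sharp u
        (mvfderiv 𝓘(ℝ, E) (F₂ ∘ chartInv I x₀) u : TangentSpace 𝓘(ℝ, E) u →ₗ[ℝ] ℝ)) = _
  rw [mvfderiv_comp_chartInv_toLinearMap x₀ u h₁, mvfderiv_comp_chartInv_toLinearMap x₀ u h₂,
    Lorentzian.OpensChart.sharp_eq_sharpAt hG u]
  rfl

/-- **`|∇F|²_g` read in the chart**: `|∇F|²_g(Φ u) = gradSqAt G F̂ u`. [cite: ONeill1983, Ch. 3, p. 85] -/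
theorem gradSq_chartInv_eq (x₀ : M) (u : chartTarget I x₀) {F : M → ℝ}
    (hF : MDifferentiableAt I 𝓘(ℝ, ℝ) F (chartInv I x₀ u)) :
    g.gradSq F (chartInv I x₀ u) =
      MetricCoord.gradSqAt (chartRep I (fun _ ↦ g) x₀ 0) (F ∘ (extChartAt I x₀).symm) u :=
  innerDual_chartInv_eq g x₀ u hF hF

variable [g.HasLeviCivita]

/-- **`Δ_g F` read in the chart**: `Δ_g F (Φ u) = lapAt G F̂ u` for `F` of class `C²` at `Φ u`
(`dalembertian_comap`, `OpensChart.dalembertian_eq_lapAt`). [cite: ONeill1983, Ch. 3, Prop. 3.59] -/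
theorem dalembertian_chartInv_eq (x₀ : M) (u : chartTarget I x₀) {F : M → ℝ}
    (hF : ContMDiffAt I 𝓘(ℝ, ℝ) 2 F (chartInv I x₀ u)) :
    g.dalembertian F (chartInv I x₀ u) =
      MetricCoord.lapAt (chartRep I (fun _ ↦ g) x₀ 0) (F ∘ (extChartAt I x₀).symm) u := by
  haveI := (chartPullback I g x₀).hasLeviCivita
  have hG := val_chartPullback_eq_chartRep (fun _ : ℝ ↦ g) x₀ 0
  have hrep : ContDiffAt ℝ 2 (F ∘ (extChartAt I x₀).symm) (u : E) := by
    have hsymm : ContMDiffAt 𝓘(ℝ, E) I 2 (extChartAt I x₀).symm (u : E) :=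
      (contMDiffOn_extChartAt_symm x₀).contMDiffAt
        ((isOpen_extChartAt_target x₀).mem_nhds u.2)
    exact contMDiffAt_iff_contDiffAt.1 (hF.comp (u : E) hsymm)
  rw [← g.dalembertian_comap contMDiff_pullbackBilin_holds (contMDiff_chartInv x₀)
    (injective_mfderiv_chartInv x₀) rfl hF]
  exact Lorentzian.OpensChart.dalembertian_eq_lapAt hG u (fun _ ↦ rfl) hrep

/-- **The Bakry–Émery tensor read in the chart**: a bound `K g ≤ Ric + Hess V` on `M` gives the
same bound `K G ≤ Ric(G) + Hess_G V̂` for the chart components (`ricci_comap_apply`,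
`hessian_comap_apply`, `OpensChart.ricci_eq_ricAt`, `OpensChart.hessian_eq_hessAt`).
[cite: ONeill1983, Ch. 3, Prop. 3.59] -/
theorem bakryEmery_chartInv_le (x₀ : M) (u : chartTarget I x₀) {V : M → ℝ} {K : ℝ}
    (hV : ContMDiffAt I 𝓘(ℝ, ℝ) 2 V (chartInv I x₀ u))
    (hRic : ∀ X : TangentSpace I (chartInv I x₀ u), K * g.val (chartInv I x₀ u) X X ≤
      g.ricci (chartInv I x₀ u) X X + g.hessian V (chartInv I x₀ u) X X) (Xc : E) :
    K * chartRep I (fun _ ↦ g) x₀ 0 u Xc Xc ≤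
      MetricCoord.ricAt (chartRep I (fun _ ↦ g) x₀ 0) u Xc Xc
        + MetricCoord.hessAt (chartRep I (fun _ ↦ g) x₀ 0) (V ∘ (extChartAt I x₀).symm) u Xc Xc := by
  haveI := (chartPullback I g x₀).hasLeviCivita
  have hG := val_chartPullback_eq_chartRep (fun _ : ℝ ↦ g) x₀ 0
  have hrep : ContDiffAt ℝ 2 (V ∘ (extChartAt I x₀).symm) (u : E) := by
    have hsymm : ContMDiffAt 𝓘(ℝ, E) I 2 (extChartAt I x₀).symm (u : E) :=
      (contMDiffOn_extChartAt_symm x₀).contMDiffAt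
        ((isOpen_extChartAt_target x₀).mem_nhds u.2)
    exact contMDiffAt_iff_contDiffAt.1 (hV.comp (u : E) hsymm)
  have h := hRic (mfderiv 𝓘(ℝ, E) I (chartInv I x₀) u Xc)
  rw [← Lorentzian.OpensChart.ricci_eq_ricAt hG u,
    ← Lorentzian.OpensChart.hessian_eq_hessAt hG u (f := V ∘ chartInv I x₀) (fun _ ↦ rfl) hrep,
    g.ricci_comap_apply contMDiff_pullbackBilin_holds (contMDiff_chartInv x₀)
      (injective_mfderiv_chartInv x₀) rfl u,
    g.hessian_comap_apply contMDiff_pullbackBilin_holds (contMDiff_chartInv x₀)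
      (injective_mfderiv_chartInv x₀) rfl hV, chartRep_apply, val_chartPullback_apply]
  exact h

omit [g.HasLeviCivita] in
/-- **`|Hess F|²_G ≥ 0` in the chart of a Riemannian metric** (`OpensChart.normSq_eq_normSqAt` and
`normSq_nonneg` for the Riemannian metric `Φ^* g` on the chart target).
[cite: ONeill1983, Ch. 3, pp. 60–61] -/
theorem normSqAt_hessAt_chartRep_nonneg [g.HasLeviCivita] (hR : g.IsRiemannian) (x₀ : M)
    (u : chartTarget I x₀) {F : M → ℝ} (hF : ContMDiffAt I 𝓘(ℝ, ℝ) 2 F (chartInv I x₀ u)) :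
    0 ≤ MetricCoord.normSqAt (chartRep I (fun _ ↦ g) x₀ 0) u
      (MetricCoord.hessAt (chartRep I (fun _ ↦ g) x₀ 0) (F ∘ (extChartAt I x₀).symm) u) := by
  haveI := (chartPullback I g x₀).hasLeviCivita
  have hG := val_chartPullback_eq_chartRep (fun _ : ℝ ↦ g) x₀ 0
  have hrep : ContDiffAt ℝ 2 (F ∘ (extChartAt I x₀).symm) (u : E) := by
    have hsymm : ContMDiffAt 𝓘(ℝ, E) I 2 (extChartAt I x₀).symm (u : E) :=
      (contMDiffOn_extChartAt_symm x₀).contMDiffAt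
        ((isOpen_extChartAt_target x₀).mem_nhds u.2)
    exact contMDiffAt_iff_contDiffAt.1 (hF.comp (u : E) hsymm)
  have hpos : (chartPullback I g x₀).IsRiemannian := fun y v hv ↦
    chartPullback_pos g x₀ y (fun w hw ↦ hR _ w hw) v hv
  rw [← Lorentzian.OpensChart.normSq_eq_normSqAt hG u
    ((chartPullback I g x₀).hessian (F ∘ chartInv I x₀) u) _
    (fun v w ↦ Lorentzian.OpensChart.hessian_eq_hessAt hG u (f := F ∘ chartInv I x₀)
      (fun _ ↦ rfl) hrep v w)]
  exact (chartPullback I g x₀).normSq_nonneg u hpos _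

omit [g.HasLeviCivita] in
/-- **`|∇F|²_g` is smooth for smooth `F`** (read in each chart it is `gradSqAt G F̂ ∘ φ`,
`IsMetricOn.contDiffOn_gradSqAt`). [folklore] -/
theorem contMDiff_gradSq {F : M → ℝ} (hF : ContMDiff I 𝓘(ℝ, ℝ) ∞ F) :
    ContMDiff I 𝓘(ℝ, ℝ) ∞ (g.gradSq F) := by
  intro x₀
  set G := chartRep I (fun _ ↦ g) x₀ 0 with hGdef
  have hGm : MetricCoord.IsMetricOn G (extChartAt I x₀).target := Lorentzian.OpensChart.isMetricOn_repr (val_chartPullback_eq_chartRep (fun _ : ℝ ↦ g) x₀ 0)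
  have hFrep : ContDiffOn ℝ ∞ (F ∘ (extChartAt I x₀).symm) (extChartAt I x₀).target := by
    rw [← contMDiffOn_iff_contDiffOn]
    exact hF.comp_contMDiffOn (contMDiffOn_extChartAt_symm x₀)
  have hĝ : ContDiffOn ℝ ∞ (MetricCoord.gradSqAt G (F ∘ (extChartAt I x₀).symm))
      (extChartAt I x₀).target := hGm.contDiffOn_gradSqAt hFrep
  -- on the chart source, `g.gradSq F = gradSqAt G F̂ ∘ extChartAt`
  have heq : ∀ y ∈ (chartAt H x₀).source, g.gradSq F y =
      MetricCoord.gradSqAt G (F ∘ (extChartAt I x₀).symm) (extChartAt I x₀ y) := by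
    intro y hy
    have hu : extChartAt I x₀ y ∈ (extChartAt I x₀).target :=
      (extChartAt I x₀).map_source (by rwa [extChartAt_source])
    have h := gradSq_chartInv_eq g x₀ ⟨extChartAt I x₀ y, hu⟩
      (F := F) (by rw [chartInv_extChartAt x₀ hy]; exact hF.mdifferentiableAt (by simp) )
    rw [chartInv_extChartAt x₀ hy] at h
    exact h
  have hcomp : ContMDiffOn I 𝓘(ℝ, ℝ) ∞
      (fun y ↦ MetricCoord.gradSqAt G (F ∘ (extChartAt I x₀).symm) (extChartAt I x₀ y))
      (chartAt H x₀).source := by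
    have h1 : ContMDiffOn 𝓘(ℝ, E) 𝓘(ℝ, ℝ) ∞ (MetricCoord.gradSqAt G (F ∘ (extChartAt I x₀).symm))
        (extChartAt I x₀).target := contMDiffOn_iff_contDiffOn.2 hĝ
    refine h1.comp (contMDiffOn_extChartAt (n := ∞)) fun y hy ↦ ?_
    exact (extChartAt I x₀).map_source (by rwa [extChartAt_source])
  have hsrc : (chartAt H x₀).source ∈ 𝓝 x₀ := (chartAt H x₀).open_source.mem_nhds (mem_chart_source H x₀)
  refine ((hcomp.contMDiffAt hsrc).congr_of_eventuallyEq ?_)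
  filter_upwards [hsrc] with y hy
  exact heq y hy

end ChartBridge

/-! ### The pointwise dissipation inequality on the manifold -/

section Pointwise

variable {E : Type*} [NormedAddCommGroup E] [NormedSpace ℝ E] [FiniteDimensional ℝ E]
  {H : Type*} [TopologicalSpace H] {I : ModelWithCorners ℝ E H} [I.Boundaryless]
  {M : Type*} [TopologicalSpace M] [ChartedSpace H M] [IsManifold I ∞ M]
  (g : PseudoRiemannianMetric I ∞ E (TangentSpace I : M → Type _)) [g.HasLeviCivita]

omit [g.HasLeviCivita] [FiniteDimensional ℝ E] [I.Boundaryless] in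
/-- Representatives of a family `C^∞` on `M × S` are `C^∞` on `(chart target) × S`. This is the
tree's `contDiffOn_time_chart` (`Riemannian/TimeDerivativeContinuity`) at `k = ∞`; the name is kept
as a one-line restatement because `Riemannian/WeightedHeatFlowAPriori` uses it (dedup-00800).
[folklore] -/
theorem contDiffOn_family_comp_extChartAt_symm {f : ℝ → M → ℝ} {S : Set ℝ}
    (hf : ContMDiffOn (I.prod 𝓘(ℝ, ℝ)) 𝓘(ℝ, ℝ) ∞ (fun p : M × ℝ ↦ f p.2 p.1) (univ ×ˢ S))
    (x₀ : M) :
    ContDiffOn ℝ ∞ (fun p : E × ℝ ↦ f p.2 ((extChartAt I x₀).symm p.1))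
      ((extChartAt I x₀).target ×ˢ S) :=
  contDiffOn_time_chart hf x₀

/-- **The pointwise dissipation inequality of the Bakry–Émery strategy on a Riemannian manifold**
(any model space; Carrillo–Ni 2009, §3, p. 8, made pointwise). Let `g` be Riemannian with
`Ric + Hess V ≥ K g` (`V ∈ C^∞`), and `f : ℝ → M → ℝ` `C^∞` on `M × S` (time set `S` with unique
derivatives, `S ⊆ closure (interior S)`) solving on `M`, at each time of `S`,
`∂ₜf = Lf − |∇f|²`, `L = Δ_g − g⁻¹(dV, d·)` (the equation of `f = −log u` for a positive
solution `u` of the weighted heat equation `∂ₜu = Lu`). Then at every `x`, `t ∈ S`: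

  `∂ₜ|∇f|² ≤ L|∇f|² − 2 g⁻¹(df, d|∇f|²) − 2K |∇f|²`.

Proof: read everything in the chart at `x` (the bridges of `§ ChartBridge`), apply the coordinate
identity `MetricCoord.IsMetricOn.fisher_identity`
(`∂ₜ|∇f|² − L|∇f|² + 2⟨∇f,∇|∇f|²⟩ = −2|Hess f|² − 2Ric_V(∇f,∇f)`), and drop `|Hess f|² ≥ 0`,
`Ric_V(∇f, ∇f) ≥ K|∇f|²`. [cite: CarrilloNi2009, §3 (p. 8)] -/
theorem fisher_pointwise_le (hR : g.IsRiemannian) {V : M → ℝ} {K : ℝ}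
    (hV : ContMDiff I 𝓘(ℝ, ℝ) ∞ V)
    (hRic : ∀ (y : M) (X : TangentSpace I y), K * g.val y X X ≤ g.ricci y X X + g.hessian V y X X)
    {f : ℝ → M → ℝ} {S : Set ℝ} (hS : UniqueDiffOn ℝ S) (hS' : S ⊆ closure (interior S))
    (hf : ContMDiffOn (I.prod 𝓘(ℝ, ℝ)) 𝓘(ℝ, ℝ) ∞ (fun p : M × ℝ ↦ f p.2 p.1) (univ ×ˢ S))
    (heq : ∀ t ∈ S, ∀ y : M, derivWithin (fun s ↦ f s y) S t =
      g.dalembertian (f t) y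
        - g.innerDual y (mvfderiv I V y : TangentSpace I y →ₗ[ℝ] ℝ)
            (mvfderiv I (f t) y : TangentSpace I y →ₗ[ℝ] ℝ)
        - g.gradSq (f t) y)
    (x : M) {t : ℝ} (ht : t ∈ S) :
    derivWithin (fun s ↦ g.gradSq (f s) x) S t ≤
      (g.dalembertian (g.gradSq (f t)) x
        - g.innerDual x (mvfderiv I V x : TangentSpace I x →ₗ[ℝ] ℝ)
            (mvfderiv I (g.gradSq (f t)) x : TangentSpace I x →ₗ[ℝ] ℝ))
      - 2 * g.innerDual x (mvfderiv I (f t) x : TangentSpace I x →ₗ[ℝ] ℝ)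
            (mvfderiv I (g.gradSq (f t)) x : TangentSpace I x →ₗ[ℝ] ℝ)
      - 2 * K * g.gradSq (f t) x := by
  -- the chart at `x`, the components `G`, the representatives `F̂`, `V̂`
  set G := chartRep I (fun _ ↦ g) x 0 with hGdef
  have hGm : MetricCoord.IsMetricOn G (extChartAt I x).target := Lorentzian.OpensChart.isMetricOn_repr (val_chartPullback_eq_chartRep (fun _ : ℝ ↦ g) x 0)
  set Fh : ℝ → E → ℝ := fun s z ↦ f s ((extChartAt I x).symm z) with hFhdef
  set Vh : E → ℝ := V ∘ (extChartAt I x).symm with hVhdef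
  have hu₀ : extChartAt I x x ∈ (extChartAt I x).target := mem_extChartAt_target x
  set u₀ : chartTarget I x := ⟨extChartAt I x x, hu₀⟩ with hu₀def
  have hΦu₀ : chartInv I x u₀ = x := extChartAt_to_inv x
  -- smoothness of the slices and representatives
  have hslice : ∀ s ∈ S, ContMDiff I 𝓘(ℝ, ℝ) ∞ (f s) := fun s hs ↦
    hf.comp_contMDiff (contMDiff_id.prodMk contMDiff_const) fun y ↦ ⟨mem_univ _, hs⟩
  have hFh : ContDiffOn ℝ ∞ (fun p : E × ℝ ↦ Fh p.2 p.1) ((extChartAt I x).target ×ˢ S) :=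
    contDiffOn_time_chart hf x
  have hVh : ContDiffOn ℝ ∞ Vh (extChartAt I x).target := by
    rw [hVhdef, ← contMDiffOn_iff_contDiffOn]
    exact hV.comp_contMDiffOn (contMDiffOn_extChartAt_symm x)
  -- the equation read in the chart
  have heq' : ∀ z ∈ (extChartAt I x).target, MetricCoord.tDerivFun Fh S t z =
      MetricCoord.lapAt G (Fh t) z - fderiv ℝ (Fh t) z (MetricCoord.sharpAt G z (fderiv ℝ Vh z))
        - MetricCoord.gradSqAt G (Fh t) z := by
    intro z hz
    set u : chartTarget I x := ⟨z, hz⟩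
    have hy := heq t ht (chartInv I x u)
    have hft2 : ContMDiffAt I 𝓘(ℝ, ℝ) 2 (f t) (chartInv I x u) :=
      ((hslice t ht).of_le (WithTop.coe_le_coe.mpr le_top)).contMDiffAt
    have hftd : MDifferentiableAt I 𝓘(ℝ, ℝ) (f t) (chartInv I x u) :=
      (hslice t ht).mdifferentiableAt (by simp)
    have hVd : MDifferentiableAt I 𝓘(ℝ, ℝ) V (chartInv I x u) := hV.mdifferentiableAt (by simp)
    rw [dalembertian_chartInv_eq g x u hft2, innerDual_chartInv_eq g x u hVd hftd,
      gradSq_chartInv_eq g x u hftd] at hy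
    rw [MetricCoord.tDerivFun, show (fun s ↦ Fh s z) = fun s ↦ f s (chartInv I x u) from rfl, hy,
      MetricCoord.apply_sharpAt_comm (hGm.isInvertible z hz) (hGm.symm z hz)]
    rfl
  -- the coordinate identity at `(φ x, t)`
  have key := hGm.fisher_identity hS hS' hFh hVh hu₀ ht heq'
  -- transport of each term back to `x`
  have hft : ContMDiff I 𝓘(ℝ, ℝ) ∞ (f t) := hslice t ht
  have hftd : MDifferentiableAt I 𝓘(ℝ, ℝ) (f t) (chartInv I x u₀) := hft.mdifferentiableAt (by simp)
  have hVd : MDifferentiableAt I 𝓘(ℝ, ℝ) V (chartInv I x u₀) := hV.mdifferentiableAt (by simp)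
  have hQ : ContMDiff I 𝓘(ℝ, ℝ) ∞ (g.gradSq (f t)) := contMDiff_gradSq g hft
  have hQ2 : ContMDiffAt I 𝓘(ℝ, ℝ) 2 (g.gradSq (f t)) (chartInv I x u₀) :=
    (hQ.of_le (WithTop.coe_le_coe.mpr le_top)).contMDiffAt
  have hQd : MDifferentiableAt I 𝓘(ℝ, ℝ) (g.gradSq (f t)) (chartInv I x u₀) :=
    hQ.mdifferentiableAt (by simp)
  -- (a) `|∇f_s|²(x) = gradSqAt G (F̂ s) (φ x)` for all `s ∈ S`
  have hgrad : ∀ s ∈ S, g.gradSq (f s) x = MetricCoord.gradSqAt G (Fh s) (extChartAt I x x) := by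
    intro s hs
    have h := gradSq_chartInv_eq g x u₀ (F := f s)
      ((hslice s hs).mdifferentiableAt (by simp))
    rw [hΦu₀] at h
    exact h
  -- (b) the representative of `|∇f_t|²` agrees with `gradSqAt G (F̂ t)` on the target
  have hQrep : (g.gradSq (f t) ∘ (extChartAt I x).symm) =ᶠ[𝓝 (extChartAt I x x)]
      MetricCoord.gradSqAt G (Fh t) := by
    filter_upwards [(isOpen_extChartAt_target x).mem_nhds hu₀] with z hz
    exact gradSq_chartInv_eq g x ⟨z, hz⟩ (F := f t) (hft.mdifferentiableAt (by simp))
  have hQrep' : ∀ u : chartTarget I x, (g.gradSq (f t) ∘ chartInv I x) u =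
      MetricCoord.gradSqAt G (Fh t) u := fun u ↦
    gradSq_chartInv_eq g x u (F := f t) (hft.mdifferentiableAt (by simp))
  -- (c) the Laplacian of `|∇f|²`
  have hlap : g.dalembertian (g.gradSq (f t)) x =
      MetricCoord.lapAt G (MetricCoord.gradSqAt G (Fh t)) (extChartAt I x x) := by
    have h := dalembertian_chartInv_eq g x u₀ hQ2
    rw [hΦu₀] at h
    rw [h]
    exact MetricCoord.lapAt_congr_of_eventuallyEq G hQrep
  -- (d) the two first-order terms
  have hIV : g.innerDual x (mvfderiv I V x : TangentSpace I x →ₗ[ℝ] ℝ)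
      (mvfderiv I (g.gradSq (f t)) x : TangentSpace I x →ₗ[ℝ] ℝ) =
      fderiv ℝ (MetricCoord.gradSqAt G (Fh t)) (extChartAt I x x)
        (MetricCoord.sharpAt G (extChartAt I x x) (fderiv ℝ Vh (extChartAt I x x))) := by
    have h := innerDual_chartInv_eq g x u₀ hVd hQd
    rw [hΦu₀] at h
    rw [h, MetricCoord.apply_sharpAt_comm (hGm.isInvertible _ hu₀) (hGm.symm _ hu₀),
      hQrep.fderiv_eq]
  have hIf : g.innerDual x (mvfderiv I (f t) x : TangentSpace I x →ₗ[ℝ] ℝ)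
      (mvfderiv I (g.gradSq (f t)) x : TangentSpace I x →ₗ[ℝ] ℝ) =
      fderiv ℝ (MetricCoord.gradSqAt G (Fh t)) (extChartAt I x x)
        (MetricCoord.sharpAt G (extChartAt I x x) (fderiv ℝ (Fh t) (extChartAt I x x))) := by
    have h := innerDual_chartInv_eq g x u₀ hftd hQd
    rw [hΦu₀] at h
    rw [h, MetricCoord.apply_sharpAt_comm (hGm.isInvertible _ hu₀) (hGm.symm _ hu₀),
      hQrep.fderiv_eq]
    rfl
  -- (e) the time derivative
  have hderiv : derivWithin (fun s ↦ g.gradSq (f s) x) S t =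
      derivWithin (fun s ↦ MetricCoord.gradSqAt G (Fh s) (extChartAt I x x)) S t :=
    derivWithin_congr (fun s hs ↦ hgrad s hs) (hgrad t ht)
  -- (f) the signs of the right-hand side
  have hft2 : ContMDiffAt I 𝓘(ℝ, ℝ) 2 (f t) (chartInv I x u₀) :=
    (hft.of_le (WithTop.coe_le_coe.mpr le_top)).contMDiffAt
  have hN := normSqAt_hessAt_chartRep_nonneg g hR x u₀ hft2
  have hV2 : ContMDiffAt I 𝓘(ℝ, ℝ) 2 V (chartInv I x u₀) :=
    (hV.of_le (WithTop.coe_le_coe.mpr le_top)).contMDiffAt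
  have hB := bakryEmery_chartInv_le g x u₀ hV2 (fun X ↦ hRic _ X)
    (MetricCoord.sharpAt G (extChartAt I x x) (fderiv ℝ (Fh t) (extChartAt I x x)))
  have hGX : G (extChartAt I x x)
      (MetricCoord.sharpAt G (extChartAt I x x) (fderiv ℝ (Fh t) (extChartAt I x x)))
      (MetricCoord.sharpAt G (extChartAt I x x) (fderiv ℝ (Fh t) (extChartAt I x x))) =
      g.gradSq (f t) x := by
    rw [MetricCoord.apply_sharpAt_sharpAt (hGm.isInvertible _ hu₀), hgrad t ht]
    rfl
  rw [hderiv, hlap, hIV, hIf]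
  have hN' : 0 ≤ MetricCoord.normSqAt G (extChartAt I x x)
      (MetricCoord.hessAt G (Fh t) (extChartAt I x x)) := hN
  have hB' : K * g.gradSq (f t) x ≤
      MetricCoord.ricAt G (extChartAt I x x)
          (MetricCoord.sharpAt G (extChartAt I x x) (fderiv ℝ (Fh t) (extChartAt I x x)))
          (MetricCoord.sharpAt G (extChartAt I x x) (fderiv ℝ (Fh t) (extChartAt I x x)))
        + MetricCoord.hessAt G Vh (extChartAt I x x)
          (MetricCoord.sharpAt G (extChartAt I x x) (fderiv ℝ (Fh t) (extChartAt I x x)))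
          (MetricCoord.sharpAt G (extChartAt I x x) (fderiv ℝ (Fh t) (extChartAt I x x))) := by
    rw [← hGX]
    exact hB
  linarith [key, hN', hB']

end Pointwise

end Literature.Geometry.Riemannian


/-! ## PART 3 — joint smoothness of `g⁻¹(df₁, df₂)` along families; the static Leibniz rule -/

namespace Literature.Geometry.Riemannian

open Lorentzian Lorentzian.PseudoRiemannianMetric _root_.MeasureTheory

section FamilySmooth

variable {E : Type*} [NormedAddCommGroup E] [NormedSpace ℝ E] [FiniteDimensional ℝ E]
  {H : Type*} [TopologicalSpace H] {I : ModelWithCorners ℝ E H} [I.Boundaryless]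
  {M : Type*} [TopologicalSpace M] [ChartedSpace H M] [IsManifold I ∞ M]
  (g : PseudoRiemannianMetric I ∞ E (TangentSpace I : M → Type _))

/-- **`(x, t) ↦ g⁻¹(d f₁(t,·), d f₂(t,·))(x)` is `C^∞` on `M × S`** for two functions `f₁, f₂`
`C^∞` on `M × S` (`S` with unique derivatives): in the chart at `x₀` it is
`(DF̂₁)(♯_G DF̂₂)` at `(φ x, t)`, where the `y`-differentials of the representatives are `C^∞`
on `φ.target × S` (`contDiffOn_fderiv_slice`) and `♯_G` is `C^∞` in `y`. In particular
`(x, t) ↦ |∇f(t,·)|²(x)` is `C^∞` on `M × S`. [folklore] -/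
theorem contMDiffOn_innerDual_family {f₁ f₂ : ℝ → M → ℝ} {S : Set ℝ} (hS : UniqueDiffOn ℝ S)
    (h₁ : ContMDiffOn (I.prod 𝓘(ℝ, ℝ)) 𝓘(ℝ, ℝ) ∞ (fun p : M × ℝ ↦ f₁ p.2 p.1) (univ ×ˢ S))
    (h₂ : ContMDiffOn (I.prod 𝓘(ℝ, ℝ)) 𝓘(ℝ, ℝ) ∞ (fun p : M × ℝ ↦ f₂ p.2 p.1) (univ ×ˢ S)) :
    ContMDiffOn (I.prod 𝓘(ℝ, ℝ)) 𝓘(ℝ, ℝ) ∞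
      (fun p : M × ℝ ↦ g.innerDual p.1
        (mvfderiv I (f₁ p.2) p.1 : TangentSpace I p.1 →ₗ[ℝ] ℝ)
        (mvfderiv I (f₂ p.2) p.1 : TangentSpace I p.1 →ₗ[ℝ] ℝ)) (univ ×ˢ S) := by
  rintro ⟨x₀, t₀⟩ ⟨-, ht₀⟩
  set φ := extChartAt I x₀ with hφ
  set G := chartRep I (fun _ ↦ g) x₀ 0 with hGdef
  have hGm : MetricCoord.IsMetricOn G φ.target :=
    Lorentzian.OpensChart.isMetricOn_repr (val_chartPullback_eq_chartRep (fun _ : ℝ ↦ g) x₀ 0)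
  set F₁ : E × ℝ → ℝ := fun q ↦ f₁ q.2 (φ.symm q.1) with hF₁
  set F₂ : E × ℝ → ℝ := fun q ↦ f₂ q.2 (φ.symm q.1) with hF₂
  have hF₁c : ContDiffOn ℝ ∞ F₁ (φ.target ×ˢ S) := contDiffOn_time_chart (k := (⊤ : ℕ∞)) h₁ x₀
  have hF₂c : ContDiffOn ℝ ∞ F₂ (φ.target ×ˢ S) := contDiffOn_time_chart (k := (⊤ : ℕ∞)) h₂ x₀
  have hT : IsOpen φ.target := isOpen_extChartAt_target x₀
  -- the `y`-differentials of the representatives are `C^∞` on `φ.target × S`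
  have hD₁ : ContDiffOn ℝ ∞ (fun q : E × ℝ ↦ fderiv ℝ (fun y ↦ F₁ (y, q.2)) q.1) (φ.target ×ˢ S) :=
    Lorentzian.MetricCoord.contDiffOn_fderiv_slice hT hS hF₁c
  have hD₂ : ContDiffOn ℝ ∞ (fun q : E × ℝ ↦ fderiv ℝ (fun y ↦ F₂ (y, q.2)) q.1) (φ.target ×ˢ S) :=
    Lorentzian.MetricCoord.contDiffOn_fderiv_slice hT hS hF₂c
  have hsh : ContDiffOn ℝ ∞ (fun q : E × ℝ ↦ MetricCoord.sharpAt G q.1) (φ.target ×ˢ S) :=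
    hGm.contDiffOn_sharpAt.comp contDiffOn_fst fun q hq ↦ hq.1
  have hcoord : ContDiffOn ℝ ∞ (fun q : E × ℝ ↦
      fderiv ℝ (fun y ↦ F₁ (y, q.2)) q.1 (MetricCoord.sharpAt G q.1 (fderiv ℝ (fun y ↦ F₂ (y, q.2)) q.1)))
      (φ.target ×ˢ S) := hD₁.clm_apply (hsh.clm_apply hD₂)
  -- the map `(x, t) ↦ (φ x, t)` is `C^∞` on `φ.source × S`
  have hψ : ContMDiffOn (I.prod 𝓘(ℝ, ℝ)) 𝓘(ℝ, E × ℝ) ∞ (fun z : M × ℝ ↦ (φ z.1, z.2))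
      (φ.source ×ˢ S) := by
    intro z hz
    have h1 : ContMDiffWithinAt (I.prod 𝓘(ℝ, ℝ)) 𝓘(ℝ, E) ∞ (fun z : M × ℝ ↦ φ z.1)
        (φ.source ×ˢ S) z := by
      have hsrc : z.1 ∈ (chartAt H x₀).source := by
        simpa only [hφ, extChartAt_source] using hz.1
      exact ((contMDiffOn_extChartAt (I := I) (n := ∞) (x := x₀)) z.1 hsrc).comp z
        contMDiffWithinAt_fst (fun w hw ↦ by simpa only [hφ, extChartAt_source] using hw.1)
    exact h1.prodMk_space contMDiffWithinAt_snd
  have hmaps : (φ.source ×ˢ S) ⊆ (fun z : M × ℝ ↦ (φ z.1, z.2)) ⁻¹' (φ.target ×ˢ S) :=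
    fun z hz ↦ ⟨φ.map_source hz.1, hz.2⟩
  have hmem : (x₀, t₀) ∈ φ.source ×ˢ S := ⟨mem_extChartAt_source x₀, ht₀⟩
  have hcomp : ContMDiffWithinAt (I.prod 𝓘(ℝ, ℝ)) 𝓘(ℝ, ℝ) ∞
      ((fun q : E × ℝ ↦ fderiv ℝ (fun y ↦ F₁ (y, q.2)) q.1
          (MetricCoord.sharpAt G q.1 (fderiv ℝ (fun y ↦ F₂ (y, q.2)) q.1))) ∘
        fun z : M × ℝ ↦ (φ z.1, z.2)) (φ.source ×ˢ S) (x₀, t₀) :=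
    ContDiffWithinAt.comp_contMDiffWithinAt (f := fun z : M × ℝ ↦ (φ z.1, z.2)) (x := (x₀, t₀))
      (hcoord _ (hmaps hmem)) (hψ _ hmem) hmaps
  -- which agrees with `g⁻¹(df₁, df₂)` there
  have hslice₁ : ∀ s ∈ S, ContMDiff I 𝓘(ℝ, ℝ) ∞ (f₁ s) := fun s hs ↦
    h₁.comp_contMDiff (contMDiff_id.prodMk contMDiff_const) fun y ↦ ⟨mem_univ _, hs⟩
  have hslice₂ : ∀ s ∈ S, ContMDiff I 𝓘(ℝ, ℝ) ∞ (f₂ s) := fun s hs ↦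
    h₂.comp_contMDiff (contMDiff_id.prodMk contMDiff_const) fun y ↦ ⟨mem_univ _, hs⟩
  have hagree : ∀ z ∈ φ.source ×ˢ S, g.innerDual z.1
      (mvfderiv I (f₁ z.2) z.1 : TangentSpace I z.1 →ₗ[ℝ] ℝ)
      (mvfderiv I (f₂ z.2) z.1 : TangentSpace I z.1 →ₗ[ℝ] ℝ) =
      ((fun q : E × ℝ ↦ fderiv ℝ (fun y ↦ F₁ (y, q.2)) q.1
          (MetricCoord.sharpAt G q.1 (fderiv ℝ (fun y ↦ F₂ (y, q.2)) q.1))) ∘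
        fun z : M × ℝ ↦ (φ z.1, z.2)) z := by
    rintro ⟨x, t⟩ ⟨hx, ht⟩
    have hxs : x ∈ (chartAt H x₀).source := by simpa only [hφ, extChartAt_source] using hx
    have hu : φ x ∈ φ.target := φ.map_source hx
    have h := innerDual_chartInv_eq g x₀ ⟨φ x, hu⟩ (F₁ := f₁ t) (F₂ := f₂ t)
      (by rw [chartInv_extChartAt x₀ hxs]; exact (hslice₁ t ht).mdifferentiableAt (by simp))
      (by rw [chartInv_extChartAt x₀ hxs]; exact (hslice₂ t ht).mdifferentiableAt (by simp))
    rw [chartInv_extChartAt x₀ hxs] at h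
    exact h
  have hloc : ContMDiffWithinAt (I.prod 𝓘(ℝ, ℝ)) 𝓘(ℝ, ℝ) ∞
      (fun p : M × ℝ ↦ g.innerDual p.1
        (mvfderiv I (f₁ p.2) p.1 : TangentSpace I p.1 →ₗ[ℝ] ℝ)
        (mvfderiv I (f₂ p.2) p.1 : TangentSpace I p.1 →ₗ[ℝ] ℝ)) (φ.source ×ˢ S) (x₀, t₀) :=
    hcomp.congr (fun z hz ↦ hagree z hz) (hagree _ hmem)
  -- `φ.source × S` is a neighbourhood of `(x₀, t₀)` within `M × S`
  have hnhds : φ.source ×ˢ S ∈ 𝓝[univ ×ˢ S] (x₀, t₀) := by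
    have h1 : φ.source ×ˢ (univ : Set ℝ) ∈ 𝓝 (x₀, t₀) :=
      prod_mem_nhds (extChartAt_source_mem_nhds x₀) univ_mem
    have h2 : φ.source ×ˢ S = (univ ×ˢ S) ∩ (φ.source ×ˢ (univ : Set ℝ)) := by
      ext z; simp only [mem_prod, mem_univ, true_and, and_true, mem_inter_iff]; tauto
    rw [h2]
    exact inter_mem_nhdsWithin _ h1
  exact hloc.mono_of_mem_nhdsWithin hnhds

/-- `(x, t) ↦ |∇f(t,·)|²(x)` is `C^∞` on `M × S`. [folklore] -/
theorem contMDiffOn_gradSq_family {f : ℝ → M → ℝ} {S : Set ℝ} (hS : UniqueDiffOn ℝ S)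
    (hf : ContMDiffOn (I.prod 𝓘(ℝ, ℝ)) 𝓘(ℝ, ℝ) ∞ (fun p : M × ℝ ↦ f p.2 p.1) (univ ×ˢ S)) :
    ContMDiffOn (I.prod 𝓘(ℝ, ℝ)) 𝓘(ℝ, ℝ) ∞ (fun p : M × ℝ ↦ g.gradSq (f p.2) p.1) (univ ×ˢ S) :=
  contMDiffOn_innerDual_family g hS hf hf

variable [g.HasLeviCivita]

/-- `(x, t) ↦ Δ_g f(t,·)(x)` is `C^∞` on `M × S` when `f` is: in the chart at `x₀` it is
`lapAt G F̂_t (φ x)`… — here we only need and prove the weaker statement that for a STATIC `C^∞`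
function `F`, `Δ_g F` is `C^∞` (`dalembertian_chartInv_eq`, `IsMetricOn.contDiffOn_lapAt`).
[folklore] -/
theorem contMDiff_dalembertian {F : M → ℝ} (hF : ContMDiff I 𝓘(ℝ, ℝ) ∞ F) :
    ContMDiff I 𝓘(ℝ, ℝ) ∞ (g.dalembertian F) := by
  intro x₀
  set G := chartRep I (fun _ ↦ g) x₀ 0 with hGdef
  have hGm : MetricCoord.IsMetricOn G (extChartAt I x₀).target :=
    Lorentzian.OpensChart.isMetricOn_repr (val_chartPullback_eq_chartRep (fun _ : ℝ ↦ g) x₀ 0)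
  have hFrep : ContDiffOn ℝ ∞ (F ∘ (extChartAt I x₀).symm) (extChartAt I x₀).target := by
    rw [← contMDiffOn_iff_contDiffOn]
    exact hF.comp_contMDiffOn (contMDiffOn_extChartAt_symm x₀)
  have hΔ : ContDiffOn ℝ ∞ (MetricCoord.lapAt G (F ∘ (extChartAt I x₀).symm))
      (extChartAt I x₀).target := hGm.contDiffOn_lapAt hFrep
  have heq : ∀ y ∈ (chartAt H x₀).source, g.dalembertian F y =
      MetricCoord.lapAt G (F ∘ (extChartAt I x₀).symm) (extChartAt I x₀ y) := by
    intro y hy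
    have hu : extChartAt I x₀ y ∈ (extChartAt I x₀).target :=
      (extChartAt I x₀).map_source (by rwa [extChartAt_source])
    have h := dalembertian_chartInv_eq g x₀ ⟨extChartAt I x₀ y, hu⟩ (F := F)
      (by rw [chartInv_extChartAt x₀ hy]; exact (hF.of_le (WithTop.coe_le_coe.mpr le_top)).contMDiffAt)
    rw [chartInv_extChartAt x₀ hy] at h
    exact h
  have hcomp : ContMDiffOn I 𝓘(ℝ, ℝ) ∞
      (fun y ↦ MetricCoord.lapAt G (F ∘ (extChartAt I x₀).symm) (extChartAt I x₀ y))
      (chartAt H x₀).source := by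
    have h1 : ContMDiffOn 𝓘(ℝ, E) 𝓘(ℝ, ℝ) ∞ (MetricCoord.lapAt G (F ∘ (extChartAt I x₀).symm))
        (extChartAt I x₀).target := contMDiffOn_iff_contDiffOn.2 hΔ
    refine h1.comp (contMDiffOn_extChartAt (n := ∞)) fun y hy ↦ ?_
    exact (extChartAt I x₀).map_source (by rwa [extChartAt_source])
  have hsrc : (chartAt H x₀).source ∈ 𝓝 x₀ := (chartAt H x₀).open_source.mem_nhds (mem_chart_source H x₀)
  refine ((hcomp.contMDiffAt hsrc).congr_of_eventuallyEq ?_)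
  filter_upwards [hsrc] with y hy
  exact heq y hy

end FamilySmooth

/-! ### The static Leibniz rule on a closed manifold -/

section Leibniz

variable {M : Type*} [TopologicalSpace M] [CompactSpace M] [MeasurableSpace M]
  [OpensMeasurableSpace M]

omit [CompactSpace M] [MeasurableSpace M] [OpensMeasurableSpace M] in
/-- A function jointly continuous on `M × S` has continuous slices; this is the tree's
`continuous_slice_of_continuousOn_prod` (`Riemannian/RicciFlowIntegralDeriv`), kept under its old
name as a deprecated alias (dedup-00801). [folklore] -/
@[deprecated continuous_slice_of_continuousOn_prod (since := "2026-08-15")]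
theorem continuous_slice_of_continuousOn_prod' {F : ℝ → M → ℝ} {S : Set ℝ}
    (hF : ContinuousOn (fun z : M × ℝ ↦ F z.2 z.1) (univ ×ˢ S)) {t : ℝ} (ht : t ∈ S) :
    Continuous fun p : M ↦ F t p :=
  continuous_slice_of_continuousOn_prod hF ht

omit [MeasurableSpace M] [OpensMeasurableSpace M] in
/-- A function jointly continuous on `M × S`, `M` compact, is bounded on `M × K` for compact
`K ⊆ S`; this is the tree's `exists_forall_abs_le_of_continuousOn_prod`
(`Riemannian/RicciFlowIntegralDeriv`), kept under its old name as a deprecated alias (dedup-00802).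
[folklore] -/
@[deprecated exists_forall_abs_le_of_continuousOn_prod (since := "2026-08-15")]
theorem exists_forall_abs_le_of_continuousOn_prod' {F : ℝ → M → ℝ} {S : Set ℝ}
    (hF : ContinuousOn (fun z : M × ℝ ↦ F z.2 z.1) (univ ×ˢ S)) {K : Set ℝ} (hK : IsCompact K)
    (hKS : K ⊆ S) : ∃ C : ℝ, 0 ≤ C ∧ ∀ t ∈ K, ∀ p : M, |F t p| ≤ C :=
  exists_forall_abs_le_of_continuousOn_prod hF hK hKS

/-- **The Leibniz rule `d/dt ∫_M F(t, ·) dμ = ∫_M ∂ₜF(t, ·) dμ` on a compact space, at interior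
times**: `μ` a finite Borel measure on the compact `M`, `F, F'` jointly continuous on `M × S`
with `∂ₜF(t, p) = F'(t, p)` (derivative within `S`) — then at every interior time `t₀` of `S`
the parametric integral is differentiable with derivative `∫ F'(t₀, ·) dμ` (differentiation under
the integral sign, Mathlib's `hasDerivAt_integral_of_dominated_loc_of_deriv_le`, the derivative
being bounded on `M × [t₀ − ε, t₀ + ε]` by continuity). [folklore] -/
theorem hasDerivAt_integral_of_continuousOn_prod (μ : Measure M) [IsFiniteMeasure μ]
    {S : Set ℝ} {F F' : ℝ → M → ℝ}
    (hF : ContinuousOn (fun z : M × ℝ ↦ F z.2 z.1) (univ ×ˢ S))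
    (hF' : ContinuousOn (fun z : M × ℝ ↦ F' z.2 z.1) (univ ×ˢ S))
    (hd : ∀ p : M, ∀ t ∈ S, HasDerivWithinAt (F · p) (F' t p) S t)
    {t₀ : ℝ} (ht₀ : t₀ ∈ interior S) :
    HasDerivAt (fun t ↦ ∫ p, F t p ∂μ) (∫ p, F' t₀ p ∂μ) t₀ := by
  have ht₀S : t₀ ∈ S := interior_subset ht₀
  obtain ⟨ε, hε, hεS⟩ : ∃ ε > 0, Metric.closedBall t₀ ε ⊆ interior S :=
    Metric.nhds_basis_closedBall.mem_iff.1 (isOpen_interior.mem_nhds ht₀)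
  set a : ℝ := t₀ - ε with ha
  set b : ℝ := t₀ + ε with hb
  have hIcc : Icc a b ⊆ interior S := fun t ht ↦ hεS (by
    rw [Metric.mem_closedBall, Real.dist_eq, abs_le]; constructor <;> linarith [ht.1, ht.2])
  have hIccS : Icc a b ⊆ S := hIcc.trans interior_subset
  have ht₀ab : t₀ ∈ Icc a b := ⟨by linarith, by linarith⟩
  have hFx : ∀ t ∈ S, Continuous fun p : M ↦ F t p := fun t ht ↦
    continuous_slice_of_continuousOn_prod hF ht
  have hF'x : ∀ t ∈ S, Continuous fun p : M ↦ F' t p := fun t ht ↦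
    continuous_slice_of_continuousOn_prod hF' ht
  obtain ⟨D₀, hD₀, hD₀'⟩ := exists_forall_abs_le_of_continuousOn_prod hF isCompact_Icc hIccS
  obtain ⟨D₁, hD₁, hD₁'⟩ := exists_forall_abs_le_of_continuousOn_prod hF' isCompact_Icc hIccS
  have hderiv : ∀ (p : M), ∀ t ∈ Icc a b, HasDerivAt (F · p) (F' t p) t := by
    intro p t ht
    have htS : S ∈ 𝓝 t := mem_interior_iff_mem_nhds.1 (hIcc ht)
    exact (hd p t (hIccS ht)).hasDerivAt htS
  have hbound : ∀ (p : M), ∀ t ∈ Icc a b, ‖F' t p‖ ≤ D₁ := fun p t ht ↦ by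
    rw [Real.norm_eq_abs]; exact hD₁' t ht p
  have hint₀ : Integrable (F t₀) μ := by
    refine (integrable_const D₀).mono' (hFx t₀ ht₀S).aestronglyMeasurable
      (Filter.Eventually.of_forall fun p ↦ ?_)
    rw [Real.norm_eq_abs]
    exact hD₀' t₀ ht₀ab p
  have hmain := hasDerivAt_integral_of_dominated_loc_of_deriv_le (μ := μ) (F := F) (F' := F')
    (x₀ := t₀) (s := Icc a b) (bound := fun _ ↦ D₁)
    (Icc_mem_nhds (by linarith) (by linarith))
    (Filter.eventually_of_mem (isOpen_interior.mem_nhds ht₀) fun t ht ↦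
      (hFx t (interior_subset ht)).aestronglyMeasurable)
    hint₀ ((hF'x t₀ ht₀S).aestronglyMeasurable)
    (Filter.Eventually.of_forall fun p t ht ↦ hbound p t ht)
    (integrable_const _)
    (Filter.Eventually.of_forall fun p t ht ↦ hderiv p t ht)
  exact hmain.2

/-- **Continuity of the parametric integral `t ↦ ∫_M F(t, ·) dμ` on `S`** for `F` jointly
continuous on `M × S`, `M` compact, `μ` finite (dominated convergence along sequences / Mathlib's
`continuousOn_of_dominated` with a locally uniform bound). [folklore] -/
theorem continuousOn_integral_of_continuousOn_prod (μ : Measure M) [IsFiniteMeasure μ]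
    {S : Set ℝ} (hSc : IsClosed S) {F : ℝ → M → ℝ}
    (hF : ContinuousOn (fun z : M × ℝ ↦ F z.2 z.1) (univ ×ˢ S)) :
    ContinuousOn (fun t ↦ ∫ p, F t p ∂μ) S := by
  intro t₀ ht₀
  -- a compact neighbourhood `[t₀ - 1, t₀ + 1] ∩ S` of `t₀` in `S`
  have hK : IsCompact (Icc (t₀ - 1) (t₀ + 1) ∩ S) := isCompact_Icc.inter_right hSc
  obtain ⟨C, hC, hC'⟩ := exists_forall_abs_le_of_continuousOn_prod hF hK inter_subset_right
  have hFx : ∀ t ∈ S, Continuous fun p : M ↦ F t p := fun t ht ↦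
    continuous_slice_of_continuousOn_prod hF ht
  have hnhds : Icc (t₀ - 1) (t₀ + 1) ∩ S ∈ 𝓝[S] t₀ := by
    rw [Set.inter_comm]
    exact inter_mem_nhdsWithin S (Icc_mem_nhds (by linarith : t₀ - 1 < t₀) (by linarith : t₀ < t₀ + 1))
  refine continuousWithinAt_of_dominated (bound := fun _ ↦ C) ?_ ?_ (integrable_const C) ?_
  · filter_upwards [self_mem_nhdsWithin] with t ht
    exact (hFx t ht).aestronglyMeasurable
  · filter_upwards [hnhds] with t ht
    exact Filter.Eventually.of_forall fun p ↦ by rw [Real.norm_eq_abs]; exact hC' t ht p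
  · refine Filter.Eventually.of_forall fun p ↦ ?_
    have hc : ContinuousWithinAt (fun z : M × ℝ ↦ F z.2 z.1) (univ ×ˢ S) (p, t₀) :=
      hF (p, t₀) ⟨mem_univ _, ht₀⟩
    have hι : ContinuousWithinAt (fun t : ℝ ↦ ((p, t) : M × ℝ)) S t₀ :=
      (continuous_const.prodMk continuous_id).continuousWithinAt
    exact hc.comp hι fun t ht ↦ ⟨mem_univ _, ht⟩

end Leibniz

end Literature.Geometry.Riemannian


/-! ## PART 4 — the dissipation of the Fisher information, integrated over the closed manifold -/

namespace Literature.Geometry.Riemannian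

open Lorentzian Lorentzian.PseudoRiemannianMetric _root_.MeasureTheory

section Integrated

variable {E : Type*} [NormedAddCommGroup E] [NormedSpace ℝ E] [FiniteDimensional ℝ E]
  {H : Type*} [TopologicalSpace H] {I : ModelWithCorners ℝ E H} [I.Boundaryless]
  {M : Type*} [TopologicalSpace M] [ChartedSpace H M] [IsManifold I ∞ M]
  [CompactSpace M] [T3Space M] [MeasurableSpace M] [BorelSpace M]
  (g : PseudoRiemannianMetric I ∞ E (TangentSpace I : M → Type _)) [g.HasLeviCivita]

omit [I.Boundaryless] [CompactSpace M] [T3Space M] [MeasurableSpace M] [BorelSpace M] in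
/-- **`L(e^{-F}) = e^{-F}(|∇F|² − LF)`** for the weighted Laplacian `L = Δ_g − g⁻¹(dV, d·)` and
`F` of class `C²` at the point (`dalembertian_real_comp` with `ζ = e^{-·}` and the chain rule
for `d(e^{-F}) = −e^{-F} dF`). [folklore] -/
theorem weightedLaplacian_exp_neg {F V : M → ℝ} {x : M} (hF : ContMDiffAt I 𝓘(ℝ, ℝ) 2 F x) :
    g.dalembertian (fun y ↦ Real.exp (-F y)) x
      - g.innerDual x (mvfderiv I V x : TangentSpace I x →ₗ[ℝ] ℝ)
          (mvfderiv I (fun y ↦ Real.exp (-F y)) x : TangentSpace I x →ₗ[ℝ] ℝ) =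
      Real.exp (-F x) * (g.gradSq F x
        - (g.dalembertian F x - g.innerDual x (mvfderiv I V x : TangentSpace I x →ₗ[ℝ] ℝ)
            (mvfderiv I F x : TangentSpace I x →ₗ[ℝ] ℝ))) := by
  have hFd : MDifferentiableAt I 𝓘(ℝ, ℝ) F x := hF.mdifferentiableAt (by norm_num)
  have hζ : ContDiffAt ℝ 2 (fun t : ℝ ↦ Real.exp (-t)) (F x) :=
    (Real.contDiff_exp.comp contDiff_neg).contDiffAt
  have hd : ∀ t : ℝ, HasDerivAt (fun s : ℝ ↦ Real.exp (-s)) (-Real.exp (-t)) t := fun t ↦ by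
    simpa using (hasDerivAt_neg t).exp
  have hd1 : deriv (fun s : ℝ ↦ Real.exp (-s)) = fun t ↦ -Real.exp (-t) :=
    funext fun t ↦ (hd t).deriv
  have hd2 : deriv (deriv fun s : ℝ ↦ Real.exp (-s)) (F x) = Real.exp (-F x) := by
    rw [hd1]
    simpa using (hd (F x)).neg.deriv
  have hΔ := g.dalembertian_real_comp (ζ := fun t : ℝ ↦ Real.exp (-t)) hF hζ
  rw [show (fun y ↦ Real.exp (-F y)) = (fun t : ℝ ↦ Real.exp (-t)) ∘ F from rfl, hΔ, hd2,
    (hd (F x)).deriv]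
  have hgrad : g.innerDual x (mvfderiv I F x).toLinearMap (mvfderiv I F x).toLinearMap =
      g.gradSq F x := rfl
  have hdu : (mvfderiv I ((fun t : ℝ ↦ Real.exp (-t)) ∘ F) x : TangentSpace I x →ₗ[ℝ] ℝ) =
      (-Real.exp (-F x)) • (mvfderiv I F x : TangentSpace I x →ₗ[ℝ] ℝ) := by
    ext v
    simp only [ContinuousLinearMap.coe_coe, LinearMap.smul_apply, smul_eq_mul]
    exact mvfderiv_real_comp_apply (I := I) (hd (F x)) hFd v
  rw [hgrad, hdu, g.innerDual_smul_right]
  ring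

omit [I.Boundaryless] [CompactSpace M] [T3Space M] [MeasurableSpace M] [BorelSpace M]
  [FiniteDimensional ℝ E] [g.HasLeviCivita] [IsManifold I ∞ M] in
/-- `d(e^{-F}) = −e^{-F} dF` as linear maps. [folklore] -/
theorem mvfderiv_exp_neg_toLinearMap {F : M → ℝ} {x : M} (hF : MDifferentiableAt I 𝓘(ℝ, ℝ) F x) :
    (mvfderiv I (fun y ↦ Real.exp (-F y)) x : TangentSpace I x →ₗ[ℝ] ℝ) =
      (-Real.exp (-F x)) • (mvfderiv I F x : TangentSpace I x →ₗ[ℝ] ℝ) := by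
  have hd : HasDerivAt (fun s : ℝ ↦ Real.exp (-s)) (-Real.exp (-F x)) (F x) := by
    simpa using (hasDerivAt_neg (F x)).exp
  ext v
  simp only [ContinuousLinearMap.coe_coe, LinearMap.smul_apply, smul_eq_mul]
  exact mvfderiv_real_comp_apply (I := I) hd hF v

/-- **The dissipation of the Fisher information at a fixed time** (Carrillo–Ni 2009, §3, p. 8:
"`d/dt I_V(ρ(t)) = ∫ (−2ξ_{ij}² − 2(R_{ij} + V_{ij})ξ_iξ_j)ρ dΓ ≤ −2K ∫ |∇ξ|²ρ dΓ`"; Bakry–Émery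
1985). Let `g` be Riemannian on a closed manifold (any model), `V` smooth with
`Ric + Hess V ≥ K g`, and `f : ℝ → M → ℝ` smooth on `M × [0, ∞)` with
`∂ₜf = Lf − |∇f|²` (`L = Δ − g⁻¹(dV, d·)`, the equation of `−log` of a positive solution of the
weighted heat equation). Then for every `t ≥ 0`, with `u = e^{-f}`, `dm = e^{-V}dV_g`,

  `∫_M ∂ₜ(|∇f|² u)(t, ·) dm ≤ −2K ∫_M |∇f(t,·)|² u(t,·) dm`.

Proof: pointwise `∂ₜ(|∇f|²u) = (∂ₜ|∇f|²)u − |∇f|² (∂ₜf) u ≤ [(L|∇f|² − 2⟨∇f,∇|∇f|²⟩ − 2K|∇f|²)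
− |∇f|²(Lf − |∇f|²)] u` (`fisher_pointwise_le`), and after integration the `L`- and
gradient-terms cancel by the symmetry of `L` for `dm` (`integral_mul_weightedLaplacian`,
`integral_mul_weightedLaplacian_comm`), `L(e^{-f}) = e^{-f}(|∇f|² − Lf)` and
`d(e^{-f}) = −e^{-f} df`. [cite: CarrilloNi2009, §3 (p. 8)] -/
theorem integral_derivWithin_fisher_le (hR : g.IsRiemannian) {V : M → ℝ} {K : ℝ}
    (hV : ContMDiff I 𝓘(ℝ, ℝ) ∞ V)
    (hRic : ∀ (y : M) (X : TangentSpace I y), K * g.val y X X ≤ g.ricci y X X + g.hessian V y X X)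
    {f : ℝ → M → ℝ}
    (hf : ContMDiffOn (I.prod 𝓘(ℝ, ℝ)) 𝓘(ℝ, ℝ) ∞ (fun p : M × ℝ ↦ f p.2 p.1) (univ ×ˢ Ici 0))
    (heq : ∀ t ∈ Ici (0 : ℝ), ∀ y : M, derivWithin (fun s ↦ f s y) (Ici 0) t =
      g.dalembertian (f t) y
        - g.innerDual y (mvfderiv I V y : TangentSpace I y →ₗ[ℝ] ℝ)
            (mvfderiv I (f t) y : TangentSpace I y →ₗ[ℝ] ℝ)
        - g.gradSq (f t) y)
    {t : ℝ} (ht : t ∈ Ici (0 : ℝ)) :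
    ∫ y, derivWithin (fun s ↦ g.gradSq (f s) y * Real.exp (-f s y) * Real.exp (-V y)) (Ici 0) t
        ∂g.riemVolume ≤
      -2 * K * ∫ y, g.gradSq (f t) y * Real.exp (-f t y) * Real.exp (-V y) ∂g.riemVolume := by
  have hS : UniqueDiffOn ℝ (Ici (0 : ℝ)) := uniqueDiffOn_Ici 0
  have hS' : Ici (0 : ℝ) ⊆ closure (interior (Ici (0 : ℝ))) := by
    rw [interior_Ici, closure_Ioi]
  -- the slice at time `t` and its regularity
  have hF : ContMDiff I 𝓘(ℝ, ℝ) ∞ (f t) :=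
    hf.comp_contMDiff (contMDiff_id.prodMk contMDiff_const) fun y ↦ ⟨mem_univ _, ht⟩
  have hF1 : ContMDiff I 𝓘(ℝ, ℝ) 1 (f t) := hF.of_le (by norm_num)
  have hF2 : ContMDiff I 𝓘(ℝ, ℝ) 2 (f t) := hF.of_le (WithTop.coe_le_coe.mpr le_top)
  have hQ : ContMDiff I 𝓘(ℝ, ℝ) ∞ (g.gradSq (f t)) := contMDiff_gradSq g hF
  have hQ1 : ContMDiff I 𝓘(ℝ, ℝ) 1 (g.gradSq (f t)) := hQ.of_le (by norm_num)
  have hQ2 : ContMDiff I 𝓘(ℝ, ℝ) 2 (g.gradSq (f t)) := hQ.of_le (WithTop.coe_le_coe.mpr le_top)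
  have hV1 : ContMDiff I 𝓘(ℝ, ℝ) 1 V := hV.of_le (by norm_num)
  have hU : ContMDiff I 𝓘(ℝ, ℝ) ∞ (fun y ↦ Real.exp (-f t y)) :=
    (Real.contDiff_exp.comp contDiff_neg).comp_contMDiff hF
  have hU1 : ContMDiff I 𝓘(ℝ, ℝ) 1 (fun y ↦ Real.exp (-f t y)) := hU.of_le (by norm_num)
  have hU2 : ContMDiff I 𝓘(ℝ, ℝ) 2 (fun y ↦ Real.exp (-f t y)) :=
    hU.of_le (WithTop.coe_le_coe.mpr le_top)
  -- time derivatives within `[0, ∞)` at `t`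
  have hfd : ∀ y, HasDerivWithinAt (fun s ↦ f s y) (derivWithin (fun s ↦ f s y) (Ici 0) t)
      (Ici 0) t := fun y ↦ hasDerivWithinAt_time_of_contMDiffOn (by simp) hf y ht
  have hqfam := contMDiffOn_gradSq_family g hS hf
  have hqd : ∀ y, HasDerivWithinAt (fun s ↦ g.gradSq (f s) y)
      (derivWithin (fun s ↦ g.gradSq (f s) y) (Ici 0) t) (Ici 0) t := fun y ↦
    hasDerivWithinAt_time_of_contMDiffOn (by simp) hqfam y ht
  -- the pointwise derivative of `|∇f|² e^{-f} e^{-V}`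
  have hprod : ∀ y, derivWithin (fun s ↦ g.gradSq (f s) y * Real.exp (-f s y) * Real.exp (-V y))
      (Ici 0) t =
      (derivWithin (fun s ↦ g.gradSq (f s) y) (Ici 0) t * Real.exp (-f t y)
        + g.gradSq (f t) y * (Real.exp (-f t y) * -(derivWithin (fun s ↦ f s y) (Ici 0) t)))
        * Real.exp (-V y) := by
    intro y
    have hu : HasDerivWithinAt (fun s ↦ Real.exp (-f s y))
        (Real.exp (-f t y) * -(derivWithin (fun s ↦ f s y) (Ici 0) t)) (Ici 0) t :=
      ((hfd y).neg).exp
    exact (((hqd y).mul hu).mul_const (Real.exp (-V y))).derivWithin (hS t ht)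
  -- the pointwise bound
  have hpt := fisher_pointwise_le g hR hV hRic hS hS' hf heq
  have hbound : ∀ y, derivWithin (fun s ↦ g.gradSq (f s) y * Real.exp (-f s y) * Real.exp (-V y))
      (Ici 0) t ≤
      ((g.dalembertian (g.gradSq (f t)) y
          - g.innerDual y (mvfderiv I V y : TangentSpace I y →ₗ[ℝ] ℝ)
              (mvfderiv I (g.gradSq (f t)) y : TangentSpace I y →ₗ[ℝ] ℝ))
        - 2 * g.innerDual y (mvfderiv I (f t) y : TangentSpace I y →ₗ[ℝ] ℝ)
              (mvfderiv I (g.gradSq (f t)) y : TangentSpace I y →ₗ[ℝ] ℝ)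
        - 2 * K * g.gradSq (f t) y
        - g.gradSq (f t) y * (g.dalembertian (f t) y
            - g.innerDual y (mvfderiv I V y : TangentSpace I y →ₗ[ℝ] ℝ)
                (mvfderiv I (f t) y : TangentSpace I y →ₗ[ℝ] ℝ)
            - g.gradSq (f t) y))
        * Real.exp (-f t y) * Real.exp (-V y) := by
    intro y
    rw [hprod y, heq t ht y]
    have h1 := hpt y ht
    have hu : 0 ≤ Real.exp (-f t y) := (Real.exp_pos _).le
    have hw : 0 ≤ Real.exp (-V y) := (Real.exp_pos _).le
    have huw : 0 ≤ Real.exp (-f t y) * Real.exp (-V y) := mul_nonneg hu hw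
    nlinarith [mul_le_mul_of_nonneg_right h1 huw]
  -- continuity of everything
  have hΔQc : Continuous (g.dalembertian (g.gradSq (f t))) := continuous_dalembertian g hQ2
  have hΔFc : Continuous (g.dalembertian (f t)) := continuous_dalembertian g hF2
  have hIVQ : Continuous fun y ↦ g.innerDual y (mvfderiv I V y : TangentSpace I y →ₗ[ℝ] ℝ)
      (mvfderiv I (g.gradSq (f t)) y : TangentSpace I y →ₗ[ℝ] ℝ) :=
    continuous_innerDual_mvfderiv g hV1 hQ1
  have hIFQ : Continuous fun y ↦ g.innerDual y (mvfderiv I (f t) y : TangentSpace I y →ₗ[ℝ] ℝ)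
      (mvfderiv I (g.gradSq (f t)) y : TangentSpace I y →ₗ[ℝ] ℝ) :=
    continuous_innerDual_mvfderiv g hF1 hQ1
  have hIVF : Continuous fun y ↦ g.innerDual y (mvfderiv I V y : TangentSpace I y →ₗ[ℝ] ℝ)
      (mvfderiv I (f t) y : TangentSpace I y →ₗ[ℝ] ℝ) :=
    continuous_innerDual_mvfderiv g hV1 hF1
  have hIUQ : Continuous fun y ↦ g.innerDual y
      (mvfderiv I (fun y ↦ Real.exp (-f t y)) y : TangentSpace I y →ₗ[ℝ] ℝ)
      (mvfderiv I (g.gradSq (f t)) y : TangentSpace I y →ₗ[ℝ] ℝ) :=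
    continuous_innerDual_mvfderiv g hU1 hQ1
  have hQc : Continuous (g.gradSq (f t)) := hQ.continuous
  have hUc : Continuous fun y ↦ Real.exp (-f t y) := hU.continuous
  have hWc : Continuous fun y ↦ Real.exp (-V y) := Real.continuous_exp.comp hV.continuous.neg
  have hΔUc : Continuous (g.dalembertian fun y ↦ Real.exp (-f t y)) := continuous_dalembertian g hU2
  have hIVU : Continuous fun y ↦ g.innerDual y (mvfderiv I V y : TangentSpace I y →ₗ[ℝ] ℝ)
      (mvfderiv I (fun y ↦ Real.exp (-f t y)) y : TangentSpace I y →ₗ[ℝ] ℝ) :=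
    continuous_innerDual_mvfderiv g hV1 hU1
  -- the derivative family is smooth on `M × [0, ∞)`, hence its slice is continuous
  have hPfam : ContMDiffOn (I.prod 𝓘(ℝ, ℝ)) 𝓘(ℝ, ℝ) ∞
      (fun p : M × ℝ ↦ g.gradSq (f p.2) p.1 * Real.exp (-f p.2 p.1) * Real.exp (-V p.1))
      (univ ×ˢ Ici 0) := by
    have hu : ContMDiffOn (I.prod 𝓘(ℝ, ℝ)) 𝓘(ℝ, ℝ) ∞ (fun p : M × ℝ ↦ Real.exp (-f p.2 p.1))
        (univ ×ˢ Ici 0) := (Real.contDiff_exp.comp contDiff_neg).contMDiff.comp_contMDiffOn hf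
    have hw : ContMDiffOn (I.prod 𝓘(ℝ, ℝ)) 𝓘(ℝ, ℝ) ∞ (fun p : M × ℝ ↦ Real.exp (-V p.1))
        (univ ×ˢ Ici 0) :=
      ((Real.contDiff_exp.comp contDiff_neg).comp_contMDiff (hV.comp contMDiff_fst)).contMDiffOn
    exact (hqfam.mul hu).mul hw
  have hP'fam := contMDiffOn_derivWithin_time_of_uniqueDiffOn
    (u := fun s y ↦ g.gradSq (f s) y * Real.exp (-f s y) * Real.exp (-V y)) hS hPfam
  have hP'c : Continuous fun y ↦ derivWithin
      (fun s ↦ g.gradSq (f s) y * Real.exp (-f s y) * Real.exp (-V y)) (Ici 0) t := by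
    have h := hP'fam.continuousOn
    exact (h.comp_continuous (continuous_id.prodMk continuous_const)
      fun y ↦ ⟨mem_univ _, ht⟩ :)
  -- the integral of the bound
  have iL : Integrable (fun y ↦ derivWithin
      (fun s ↦ g.gradSq (f s) y * Real.exp (-f s y) * Real.exp (-V y)) (Ici 0) t) g.riemVolume :=
    g.integrable_of_continuous hP'c
  have hBc : Continuous fun y ↦ ((g.dalembertian (g.gradSq (f t)) y
          - g.innerDual y (mvfderiv I V y : TangentSpace I y →ₗ[ℝ] ℝ)
              (mvfderiv I (g.gradSq (f t)) y : TangentSpace I y →ₗ[ℝ] ℝ))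
        - 2 * g.innerDual y (mvfderiv I (f t) y : TangentSpace I y →ₗ[ℝ] ℝ)
              (mvfderiv I (g.gradSq (f t)) y : TangentSpace I y →ₗ[ℝ] ℝ)
        - 2 * K * g.gradSq (f t) y
        - g.gradSq (f t) y * (g.dalembertian (f t) y
            - g.innerDual y (mvfderiv I V y : TangentSpace I y →ₗ[ℝ] ℝ)
                (mvfderiv I (f t) y : TangentSpace I y →ₗ[ℝ] ℝ)
            - g.gradSq (f t) y))
        * Real.exp (-f t y) * Real.exp (-V y) :=
    (((((hΔQc.sub hIVQ).sub (continuous_const.mul hIFQ)).sub (continuous_const.mul hQc)).sub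
      (hQc.mul ((hΔFc.sub hIVF).sub hQc))).mul hUc).mul hWc
  have iB := g.integrable_of_continuous hBc
  have hmono := integral_mono iL iB fun y ↦ hbound y
  refine hmono.trans (le_of_eq ?_)
  -- named integrals
  -- A1 = ∫ (L|∇f|²) u w ; A2 = ∫ ⟨df, d|∇f|²⟩ u w ; A3 = ∫ |∇f|² u w ; A4 = ∫ |∇f|² (Lf) u w ;
  -- A5 = ∫ |∇f|⁴ u w
  have iA1 : Integrable (fun y ↦ Real.exp (-f t y) * (g.dalembertian (g.gradSq (f t)) y
      - g.innerDual y (mvfderiv I V y : TangentSpace I y →ₗ[ℝ] ℝ)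
          (mvfderiv I (g.gradSq (f t)) y : TangentSpace I y →ₗ[ℝ] ℝ)) * Real.exp (-V y))
      g.riemVolume := g.integrable_of_continuous ((hUc.mul (hΔQc.sub hIVQ)).mul hWc)
  have iA2 : Integrable (fun y ↦ g.innerDual y (mvfderiv I (f t) y : TangentSpace I y →ₗ[ℝ] ℝ)
      (mvfderiv I (g.gradSq (f t)) y : TangentSpace I y →ₗ[ℝ] ℝ) * Real.exp (-f t y)
      * Real.exp (-V y)) g.riemVolume := g.integrable_of_continuous ((hIFQ.mul hUc).mul hWc)
  have iA3 : Integrable (fun y ↦ g.gradSq (f t) y * Real.exp (-f t y) * Real.exp (-V y))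
      g.riemVolume := g.integrable_of_continuous ((hQc.mul hUc).mul hWc)
  have iA4 : Integrable (fun y ↦ g.gradSq (f t) y * (g.dalembertian (f t) y
      - g.innerDual y (mvfderiv I V y : TangentSpace I y →ₗ[ℝ] ℝ)
          (mvfderiv I (f t) y : TangentSpace I y →ₗ[ℝ] ℝ)) * Real.exp (-f t y) * Real.exp (-V y))
      g.riemVolume := g.integrable_of_continuous (((hQc.mul (hΔFc.sub hIVF)).mul hUc).mul hWc)
  have iA5 : Integrable (fun y ↦ g.gradSq (f t) y * g.gradSq (f t) y * Real.exp (-f t y)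
      * Real.exp (-V y)) g.riemVolume := g.integrable_of_continuous (((hQc.mul hQc).mul hUc).mul hWc)
  -- the bound as a combination of the named integrands
  have s1 : ∫ y, ((g.dalembertian (g.gradSq (f t)) y
          - g.innerDual y (mvfderiv I V y : TangentSpace I y →ₗ[ℝ] ℝ)
              (mvfderiv I (g.gradSq (f t)) y : TangentSpace I y →ₗ[ℝ] ℝ))
        - 2 * g.innerDual y (mvfderiv I (f t) y : TangentSpace I y →ₗ[ℝ] ℝ)
              (mvfderiv I (g.gradSq (f t)) y : TangentSpace I y →ₗ[ℝ] ℝ)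
        - 2 * K * g.gradSq (f t) y
        - g.gradSq (f t) y * (g.dalembertian (f t) y
            - g.innerDual y (mvfderiv I V y : TangentSpace I y →ₗ[ℝ] ℝ)
                (mvfderiv I (f t) y : TangentSpace I y →ₗ[ℝ] ℝ)
            - g.gradSq (f t) y))
        * Real.exp (-f t y) * Real.exp (-V y) ∂g.riemVolume =
      ∫ y, (Real.exp (-f t y) * (g.dalembertian (g.gradSq (f t)) y
          - g.innerDual y (mvfderiv I V y : TangentSpace I y →ₗ[ℝ] ℝ)
            (mvfderiv I (g.gradSq (f t)) y : TangentSpace I y →ₗ[ℝ] ℝ)) * Real.exp (-V y)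
        - 2 * (g.innerDual y (mvfderiv I (f t) y : TangentSpace I y →ₗ[ℝ] ℝ)
          (mvfderiv I (g.gradSq (f t)) y : TangentSpace I y →ₗ[ℝ] ℝ) * Real.exp (-f t y)
          * Real.exp (-V y))
        - 2 * K * (g.gradSq (f t) y * Real.exp (-f t y) * Real.exp (-V y))
        - (g.gradSq (f t) y * (g.dalembertian (f t) y
          - g.innerDual y (mvfderiv I V y : TangentSpace I y →ₗ[ℝ] ℝ)
            (mvfderiv I (f t) y : TangentSpace I y →ₗ[ℝ] ℝ)) * Real.exp (-f t y) * Real.exp (-V y))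
        + g.gradSq (f t) y * g.gradSq (f t) y * Real.exp (-f t y) * Real.exp (-V y)) ∂g.riemVolume :=
    integral_congr_ae (Filter.Eventually.of_forall fun y ↦ by ring)
  have s2 : ∫ y, (Real.exp (-f t y) * (g.dalembertian (g.gradSq (f t)) y
          - g.innerDual y (mvfderiv I V y : TangentSpace I y →ₗ[ℝ] ℝ)
            (mvfderiv I (g.gradSq (f t)) y : TangentSpace I y →ₗ[ℝ] ℝ)) * Real.exp (-V y)
        - 2 * (g.innerDual y (mvfderiv I (f t) y : TangentSpace I y →ₗ[ℝ] ℝ)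
          (mvfderiv I (g.gradSq (f t)) y : TangentSpace I y →ₗ[ℝ] ℝ) * Real.exp (-f t y)
          * Real.exp (-V y))
        - 2 * K * (g.gradSq (f t) y * Real.exp (-f t y) * Real.exp (-V y))
        - (g.gradSq (f t) y * (g.dalembertian (f t) y
          - g.innerDual y (mvfderiv I V y : TangentSpace I y →ₗ[ℝ] ℝ)
            (mvfderiv I (f t) y : TangentSpace I y →ₗ[ℝ] ℝ)) * Real.exp (-f t y) * Real.exp (-V y))
        + g.gradSq (f t) y * g.gradSq (f t) y * Real.exp (-f t y) * Real.exp (-V y)) ∂g.riemVolume =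
      ∫ y, (Real.exp (-f t y) * (g.dalembertian (g.gradSq (f t)) y
          - g.innerDual y (mvfderiv I V y : TangentSpace I y →ₗ[ℝ] ℝ)
            (mvfderiv I (g.gradSq (f t)) y : TangentSpace I y →ₗ[ℝ] ℝ)) * Real.exp (-V y)
        - 2 * (g.innerDual y (mvfderiv I (f t) y : TangentSpace I y →ₗ[ℝ] ℝ)
          (mvfderiv I (g.gradSq (f t)) y : TangentSpace I y →ₗ[ℝ] ℝ) * Real.exp (-f t y)
          * Real.exp (-V y))
        - 2 * K * (g.gradSq (f t) y * Real.exp (-f t y) * Real.exp (-V y))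
        - (g.gradSq (f t) y * (g.dalembertian (f t) y
          - g.innerDual y (mvfderiv I V y : TangentSpace I y →ₗ[ℝ] ℝ)
            (mvfderiv I (f t) y : TangentSpace I y →ₗ[ℝ] ℝ)) * Real.exp (-f t y) * Real.exp (-V y))) ∂g.riemVolume
      + ∫ y, g.gradSq (f t) y * g.gradSq (f t) y * Real.exp (-f t y) * Real.exp (-V y) ∂g.riemVolume :=
    integral_add ((((iA1.sub (iA2.const_mul 2)).sub (iA3.const_mul (2 * K))).sub iA4)) iA5
  have s3 : ∫ y, (Real.exp (-f t y) * (g.dalembertian (g.gradSq (f t)) y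
          - g.innerDual y (mvfderiv I V y : TangentSpace I y →ₗ[ℝ] ℝ)
            (mvfderiv I (g.gradSq (f t)) y : TangentSpace I y →ₗ[ℝ] ℝ)) * Real.exp (-V y)
        - 2 * (g.innerDual y (mvfderiv I (f t) y : TangentSpace I y →ₗ[ℝ] ℝ)
          (mvfderiv I (g.gradSq (f t)) y : TangentSpace I y →ₗ[ℝ] ℝ) * Real.exp (-f t y)
          * Real.exp (-V y))
        - 2 * K * (g.gradSq (f t) y * Real.exp (-f t y) * Real.exp (-V y))
        - (g.gradSq (f t) y * (g.dalembertian (f t) y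
          - g.innerDual y (mvfderiv I V y : TangentSpace I y →ₗ[ℝ] ℝ)
            (mvfderiv I (f t) y : TangentSpace I y →ₗ[ℝ] ℝ)) * Real.exp (-f t y) * Real.exp (-V y))) ∂g.riemVolume =
      ∫ y, (Real.exp (-f t y) * (g.dalembertian (g.gradSq (f t)) y
          - g.innerDual y (mvfderiv I V y : TangentSpace I y →ₗ[ℝ] ℝ)
            (mvfderiv I (g.gradSq (f t)) y : TangentSpace I y →ₗ[ℝ] ℝ)) * Real.exp (-V y)
        - 2 * (g.innerDual y (mvfderiv I (f t) y : TangentSpace I y →ₗ[ℝ] ℝ)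
          (mvfderiv I (g.gradSq (f t)) y : TangentSpace I y →ₗ[ℝ] ℝ) * Real.exp (-f t y)
          * Real.exp (-V y))
        - 2 * K * (g.gradSq (f t) y * Real.exp (-f t y) * Real.exp (-V y))) ∂g.riemVolume
      - ∫ y, g.gradSq (f t) y * (g.dalembertian (f t) y
          - g.innerDual y (mvfderiv I V y : TangentSpace I y →ₗ[ℝ] ℝ)
            (mvfderiv I (f t) y : TangentSpace I y →ₗ[ℝ] ℝ)) * Real.exp (-f t y) * Real.exp (-V y) ∂g.riemVolume :=
    integral_sub (((iA1.sub (iA2.const_mul 2)).sub (iA3.const_mul (2 * K)))) iA4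
  have s4 : ∫ y, (Real.exp (-f t y) * (g.dalembertian (g.gradSq (f t)) y
          - g.innerDual y (mvfderiv I V y : TangentSpace I y →ₗ[ℝ] ℝ)
            (mvfderiv I (g.gradSq (f t)) y : TangentSpace I y →ₗ[ℝ] ℝ)) * Real.exp (-V y)
        - 2 * (g.innerDual y (mvfderiv I (f t) y : TangentSpace I y →ₗ[ℝ] ℝ)
          (mvfderiv I (g.gradSq (f t)) y : TangentSpace I y →ₗ[ℝ] ℝ) * Real.exp (-f t y)
          * Real.exp (-V y))
        - 2 * K * (g.gradSq (f t) y * Real.exp (-f t y) * Real.exp (-V y))) ∂g.riemVolume =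
      ∫ y, (Real.exp (-f t y) * (g.dalembertian (g.gradSq (f t)) y
          - g.innerDual y (mvfderiv I V y : TangentSpace I y →ₗ[ℝ] ℝ)
            (mvfderiv I (g.gradSq (f t)) y : TangentSpace I y →ₗ[ℝ] ℝ)) * Real.exp (-V y)
        - 2 * (g.innerDual y (mvfderiv I (f t) y : TangentSpace I y →ₗ[ℝ] ℝ)
          (mvfderiv I (g.gradSq (f t)) y : TangentSpace I y →ₗ[ℝ] ℝ) * Real.exp (-f t y)
          * Real.exp (-V y))) ∂g.riemVolume
      - ∫ y, 2 * K * (g.gradSq (f t) y * Real.exp (-f t y) * Real.exp (-V y)) ∂g.riemVolume :=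
    integral_sub ((iA1.sub (iA2.const_mul 2))) (iA3.const_mul (2 * K))
  have s5 : ∫ y, (Real.exp (-f t y) * (g.dalembertian (g.gradSq (f t)) y
          - g.innerDual y (mvfderiv I V y : TangentSpace I y →ₗ[ℝ] ℝ)
            (mvfderiv I (g.gradSq (f t)) y : TangentSpace I y →ₗ[ℝ] ℝ)) * Real.exp (-V y)
        - 2 * (g.innerDual y (mvfderiv I (f t) y : TangentSpace I y →ₗ[ℝ] ℝ)
          (mvfderiv I (g.gradSq (f t)) y : TangentSpace I y →ₗ[ℝ] ℝ) * Real.exp (-f t y)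
          * Real.exp (-V y))) ∂g.riemVolume =
      ∫ y, Real.exp (-f t y) * (g.dalembertian (g.gradSq (f t)) y
          - g.innerDual y (mvfderiv I V y : TangentSpace I y →ₗ[ℝ] ℝ)
            (mvfderiv I (g.gradSq (f t)) y : TangentSpace I y →ₗ[ℝ] ℝ)) * Real.exp (-V y) ∂g.riemVolume
      - ∫ y, 2 * (g.innerDual y (mvfderiv I (f t) y : TangentSpace I y →ₗ[ℝ] ℝ)
          (mvfderiv I (g.gradSq (f t)) y : TangentSpace I y →ₗ[ℝ] ℝ) * Real.exp (-f t y)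
          * Real.exp (-V y)) ∂g.riemVolume := integral_sub iA1 (iA2.const_mul 2)
  have s6 : ∫ y, 2 * (g.innerDual y (mvfderiv I (f t) y : TangentSpace I y →ₗ[ℝ] ℝ)
          (mvfderiv I (g.gradSq (f t)) y : TangentSpace I y →ₗ[ℝ] ℝ) * Real.exp (-f t y)
          * Real.exp (-V y)) ∂g.riemVolume = 2 * ∫ y, g.innerDual y (mvfderiv I (f t) y : TangentSpace I y →ₗ[ℝ] ℝ)
          (mvfderiv I (g.gradSq (f t)) y : TangentSpace I y →ₗ[ℝ] ℝ) * Real.exp (-f t y)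
          * Real.exp (-V y) ∂g.riemVolume := integral_const_mul 2 _
  have s7 : ∫ y, 2 * K * (g.gradSq (f t) y * Real.exp (-f t y) * Real.exp (-V y)) ∂g.riemVolume = 2 * K * ∫ y, g.gradSq (f t) y * Real.exp (-f t y) * Real.exp (-V y) ∂g.riemVolume := integral_const_mul (2 * K) _
  have hsplit : ∫ y, ((g.dalembertian (g.gradSq (f t)) y
          - g.innerDual y (mvfderiv I V y : TangentSpace I y →ₗ[ℝ] ℝ)
              (mvfderiv I (g.gradSq (f t)) y : TangentSpace I y →ₗ[ℝ] ℝ))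
        - 2 * g.innerDual y (mvfderiv I (f t) y : TangentSpace I y →ₗ[ℝ] ℝ)
              (mvfderiv I (g.gradSq (f t)) y : TangentSpace I y →ₗ[ℝ] ℝ)
        - 2 * K * g.gradSq (f t) y
        - g.gradSq (f t) y * (g.dalembertian (f t) y
            - g.innerDual y (mvfderiv I V y : TangentSpace I y →ₗ[ℝ] ℝ)
                (mvfderiv I (f t) y : TangentSpace I y →ₗ[ℝ] ℝ)
            - g.gradSq (f t) y))
        * Real.exp (-f t y) * Real.exp (-V y) ∂g.riemVolume =
      ∫ y, Real.exp (-f t y) * (g.dalembertian (g.gradSq (f t)) y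
          - g.innerDual y (mvfderiv I V y : TangentSpace I y →ₗ[ℝ] ℝ)
            (mvfderiv I (g.gradSq (f t)) y : TangentSpace I y →ₗ[ℝ] ℝ)) * Real.exp (-V y) ∂g.riemVolume
      - 2 * ∫ y, g.innerDual y (mvfderiv I (f t) y : TangentSpace I y →ₗ[ℝ] ℝ)
          (mvfderiv I (g.gradSq (f t)) y : TangentSpace I y →ₗ[ℝ] ℝ) * Real.exp (-f t y)
          * Real.exp (-V y) ∂g.riemVolume
      - 2 * K * ∫ y, g.gradSq (f t) y * Real.exp (-f t y) * Real.exp (-V y) ∂g.riemVolume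
      - ∫ y, g.gradSq (f t) y * (g.dalembertian (f t) y
          - g.innerDual y (mvfderiv I V y : TangentSpace I y →ₗ[ℝ] ℝ)
            (mvfderiv I (f t) y : TangentSpace I y →ₗ[ℝ] ℝ)) * Real.exp (-f t y) * Real.exp (-V y) ∂g.riemVolume
      + ∫ y, g.gradSq (f t) y * g.gradSq (f t) y * Real.exp (-f t y) * Real.exp (-V y) ∂g.riemVolume := by
    linarith [s1, s2, s3, s4, s5, s6, s7]
  rw [hsplit]
  -- Green: A1 = ∫ |∇f|² (L u) w = A5 − A4
  have hLu : ∀ y, g.dalembertian (fun y ↦ Real.exp (-f t y)) y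
      - g.innerDual y (mvfderiv I V y : TangentSpace I y →ₗ[ℝ] ℝ)
          (mvfderiv I (fun y ↦ Real.exp (-f t y)) y : TangentSpace I y →ₗ[ℝ] ℝ) =
      Real.exp (-f t y) * (g.gradSq (f t) y - (g.dalembertian (f t) y
        - g.innerDual y (mvfderiv I V y : TangentSpace I y →ₗ[ℝ] ℝ)
            (mvfderiv I (f t) y : TangentSpace I y →ₗ[ℝ] ℝ))) := fun y ↦
    weightedLaplacian_exp_neg g (hF2.contMDiffAt)
  have e1 : ∫ y, Real.exp (-f t y) * (g.dalembertian (g.gradSq (f t)) y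
          - g.innerDual y (mvfderiv I V y : TangentSpace I y →ₗ[ℝ] ℝ)
            (mvfderiv I (g.gradSq (f t)) y : TangentSpace I y →ₗ[ℝ] ℝ)) * Real.exp (-V y)
          ∂g.riemVolume =
      ∫ y, g.gradSq (f t) y * (g.dalembertian (fun y ↦ Real.exp (-f t y)) y
          - g.innerDual y (mvfderiv I V y : TangentSpace I y →ₗ[ℝ] ℝ)
            (mvfderiv I (fun y ↦ Real.exp (-f t y)) y : TangentSpace I y →ₗ[ℝ] ℝ))
          * Real.exp (-V y) ∂g.riemVolume :=
    integral_mul_weightedLaplacian_comm g hR hU2 hQ2 hV1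
  have e2 : ∫ y, g.gradSq (f t) y * (g.dalembertian (fun y ↦ Real.exp (-f t y)) y
          - g.innerDual y (mvfderiv I V y : TangentSpace I y →ₗ[ℝ] ℝ)
            (mvfderiv I (fun y ↦ Real.exp (-f t y)) y : TangentSpace I y →ₗ[ℝ] ℝ))
          * Real.exp (-V y) ∂g.riemVolume =
      ∫ y, (g.gradSq (f t) y * g.gradSq (f t) y * Real.exp (-f t y) * Real.exp (-V y)
        - g.gradSq (f t) y * (g.dalembertian (f t) y
          - g.innerDual y (mvfderiv I V y : TangentSpace I y →ₗ[ℝ] ℝ)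
            (mvfderiv I (f t) y : TangentSpace I y →ₗ[ℝ] ℝ)) * Real.exp (-f t y) * Real.exp (-V y))
          ∂g.riemVolume := by
    refine integral_congr_ae (Filter.Eventually.of_forall fun y ↦ ?_)
    dsimp only
    rw [hLu y]
    ring
  have e3 : ∫ y, (g.gradSq (f t) y * g.gradSq (f t) y * Real.exp (-f t y) * Real.exp (-V y)
        - g.gradSq (f t) y * (g.dalembertian (f t) y
          - g.innerDual y (mvfderiv I V y : TangentSpace I y →ₗ[ℝ] ℝ)
            (mvfderiv I (f t) y : TangentSpace I y →ₗ[ℝ] ℝ)) * Real.exp (-f t y) * Real.exp (-V y))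
          ∂g.riemVolume =
      ∫ y, g.gradSq (f t) y * g.gradSq (f t) y * Real.exp (-f t y) * Real.exp (-V y) ∂g.riemVolume
      - ∫ y, g.gradSq (f t) y * (g.dalembertian (f t) y
          - g.innerDual y (mvfderiv I V y : TangentSpace I y →ₗ[ℝ] ℝ)
            (mvfderiv I (f t) y : TangentSpace I y →ₗ[ℝ] ℝ)) * Real.exp (-f t y) * Real.exp (-V y)
          ∂g.riemVolume := integral_sub iA5 iA4
  -- Green: ∫ u (L|∇f|²) w = −∫ ⟨du, d|∇f|²⟩ w = A2
  have e4 : ∫ y, Real.exp (-f t y) * (g.dalembertian (g.gradSq (f t)) y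
          - g.innerDual y (mvfderiv I V y : TangentSpace I y →ₗ[ℝ] ℝ)
            (mvfderiv I (g.gradSq (f t)) y : TangentSpace I y →ₗ[ℝ] ℝ)) * Real.exp (-V y)
          ∂g.riemVolume =
      -∫ y, g.innerDual y
          (mvfderiv I (fun y ↦ Real.exp (-f t y)) y : TangentSpace I y →ₗ[ℝ] ℝ)
          (mvfderiv I (g.gradSq (f t)) y : TangentSpace I y →ₗ[ℝ] ℝ) * Real.exp (-V y)
          ∂g.riemVolume :=
    integral_mul_weightedLaplacian g hR hU1 hQ2 hV1
  have e5 : ∫ y, g.innerDual y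
          (mvfderiv I (fun y ↦ Real.exp (-f t y)) y : TangentSpace I y →ₗ[ℝ] ℝ)
          (mvfderiv I (g.gradSq (f t)) y : TangentSpace I y →ₗ[ℝ] ℝ) * Real.exp (-V y)
          ∂g.riemVolume =
      -∫ y, g.innerDual y (mvfderiv I (f t) y : TangentSpace I y →ₗ[ℝ] ℝ)
          (mvfderiv I (g.gradSq (f t)) y : TangentSpace I y →ₗ[ℝ] ℝ) * Real.exp (-f t y)
          * Real.exp (-V y) ∂g.riemVolume := by
    rw [← integral_neg]
    refine integral_congr_ae (Filter.Eventually.of_forall fun y ↦ ?_)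
    dsimp only
    rw [mvfderiv_exp_neg_toLinearMap (hF1.mdifferentiableAt one_ne_zero), g.innerDual_smul_left]
    ring
  linarith [e1, e2, e3, e4, e5]

end Integrated

end Literature.Geometry.Riemannian


/-! ## PART 5 — exponential decay of the Fisher information; the entropy along the flow -/

namespace Literature.Geometry.Riemannian

open Lorentzian Lorentzian.PseudoRiemannianMetric _root_.MeasureTheory

section Decay

variable {E : Type*} [NormedAddCommGroup E] [NormedSpace ℝ E] [FiniteDimensional ℝ E]
  {H : Type*} [TopologicalSpace H] {I : ModelWithCorners ℝ E H} [I.Boundaryless]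
  {M : Type*} [TopologicalSpace M] [ChartedSpace H M] [IsManifold I ∞ M]
  [CompactSpace M] [T3Space M] [MeasurableSpace M] [BorelSpace M]
  (g : PseudoRiemannianMetric I ∞ E (TangentSpace I : M → Type _)) [g.HasLeviCivita]

/-- **Exponential decay of the Fisher information along the flow** (Bakry–Émery 1985;
Carrillo–Ni 2009, §3, p. 8: "`I_V(ρ(t)) ≤ I_V(ρ(0)) e^{−2Kt}` for all `t ≥ 0`"). Under the
hypotheses of `integral_derivWithin_fisher_le` (closed Riemannian manifold, any model,
`Ric + Hess V ≥ K g`, `f` smooth on `M × [0, ∞)` with `∂ₜf = Lf − |∇f|²`), the Fisher information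
`I(t) = ∫_M |∇f(t,·)|² e^{-f(t,·)} e^{-V} dV_g` satisfies `I(T) ≤ e^{−2KT} I(0)` for every
`T ≥ 0`: `t ↦ e^{2Kt} I(t)` is continuous on `[0, ∞)` (`continuousOn_integral_of_continuousOn_prod`)
with nonpositive derivative on `(0, ∞)` (`hasDerivAt_integral_of_continuousOn_prod`,
`integral_derivWithin_fisher_le`), hence nonincreasing. [cite: CarrilloNi2009, §3 (p. 8)] -/
theorem fisher_le_exp_mul (hR : g.IsRiemannian) {V : M → ℝ} {K : ℝ}
    (hV : ContMDiff I 𝓘(ℝ, ℝ) ∞ V)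
    (hRic : ∀ (y : M) (X : TangentSpace I y), K * g.val y X X ≤ g.ricci y X X + g.hessian V y X X)
    {f : ℝ → M → ℝ}
    (hf : ContMDiffOn (I.prod 𝓘(ℝ, ℝ)) 𝓘(ℝ, ℝ) ∞ (fun p : M × ℝ ↦ f p.2 p.1) (univ ×ˢ Ici 0))
    (heq : ∀ t ∈ Ici (0 : ℝ), ∀ y : M, derivWithin (fun s ↦ f s y) (Ici 0) t =
      g.dalembertian (f t) y
        - g.innerDual y (mvfderiv I V y : TangentSpace I y →ₗ[ℝ] ℝ)
            (mvfderiv I (f t) y : TangentSpace I y →ₗ[ℝ] ℝ)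
        - g.gradSq (f t) y)
    {T : ℝ} (hT : 0 ≤ T) :
    ∫ y, g.gradSq (f T) y * Real.exp (-f T y) * Real.exp (-V y) ∂g.riemVolume ≤
      Real.exp (-2 * K * T) *
        ∫ y, g.gradSq (f 0) y * Real.exp (-f 0 y) * Real.exp (-V y) ∂g.riemVolume := by
  haveI : IsFiniteMeasure g.riemVolume := ⟨g.riemVolume_univ_lt_top⟩
  have hS : UniqueDiffOn ℝ (Ici (0 : ℝ)) := uniqueDiffOn_Ici 0
  -- the integrand as a smooth family, its time derivative
  have hqfam := contMDiffOn_gradSq_family g hS hf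
  have hPfam : ContMDiffOn (I.prod 𝓘(ℝ, ℝ)) 𝓘(ℝ, ℝ) ∞
      (fun p : M × ℝ ↦ g.gradSq (f p.2) p.1 * Real.exp (-f p.2 p.1) * Real.exp (-V p.1))
      (univ ×ˢ Ici 0) := by
    have hu : ContMDiffOn (I.prod 𝓘(ℝ, ℝ)) 𝓘(ℝ, ℝ) ∞ (fun p : M × ℝ ↦ Real.exp (-f p.2 p.1))
        (univ ×ˢ Ici 0) := (Real.contDiff_exp.comp contDiff_neg).contMDiff.comp_contMDiffOn hf
    have hw : ContMDiffOn (I.prod 𝓘(ℝ, ℝ)) 𝓘(ℝ, ℝ) ∞ (fun p : M × ℝ ↦ Real.exp (-V p.1))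
        (univ ×ˢ Ici 0) :=
      ((Real.contDiff_exp.comp contDiff_neg).comp_contMDiff (hV.comp contMDiff_fst)).contMDiffOn
    exact (hqfam.mul hu).mul hw
  have hP'fam := contMDiffOn_derivWithin_time_of_uniqueDiffOn
    (u := fun s y ↦ g.gradSq (f s) y * Real.exp (-f s y) * Real.exp (-V y)) hS hPfam
  set If : ℝ → ℝ := fun s ↦
    ∫ y, g.gradSq (f s) y * Real.exp (-f s y) * Real.exp (-V y) ∂g.riemVolume with hIfdef
  -- continuity on `[0, ∞)` and the derivative at positive times
  have hIc : ContinuousOn If (Ici 0) :=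
    continuousOn_integral_of_continuousOn_prod g.riemVolume isClosed_Ici hPfam.continuousOn
  have hId : ∀ t ∈ Ioi (0 : ℝ), HasDerivAt If (∫ y, derivWithin
      (fun s ↦ g.gradSq (f s) y * Real.exp (-f s y) * Real.exp (-V y)) (Ici 0) t ∂g.riemVolume) t := by
    intro t ht
    have ht' : t ∈ interior (Ici (0 : ℝ)) := by rw [interior_Ici]; exact ht
    exact hasDerivAt_integral_of_continuousOn_prod g.riemVolume hPfam.continuousOn
      hP'fam.continuousOn
      (fun y s hs ↦ hasDerivWithinAt_time_of_contMDiffOn (k := ∞)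
        (u := fun s y ↦ g.gradSq (f s) y * Real.exp (-f s y) * Real.exp (-V y))
        (by simp) hPfam y hs) ht'
  have hI'le : ∀ t ∈ Ioi (0 : ℝ), ∫ y, derivWithin
      (fun s ↦ g.gradSq (f s) y * Real.exp (-f s y) * Real.exp (-V y)) (Ici 0) t ∂g.riemVolume
      ≤ -2 * K * If t := fun t ht ↦
    integral_derivWithin_fisher_le g hR hV hRic hf heq (Set.mem_Ici.2 (le_of_lt (Set.mem_Ioi.1 ht)))
  -- `h(t) = e^{2Kt} I(t)` is nonincreasing on `[0, ∞)`
  set h : ℝ → ℝ := fun s ↦ Real.exp (2 * K * s) * If s with hhdef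
  have hhc : ContinuousOn h (Ici 0) :=
    (Real.continuous_exp.comp (continuous_const.mul continuous_id)).continuousOn.mul hIc
  have hexpd : ∀ t : ℝ, HasDerivAt (fun s ↦ Real.exp (2 * K * s)) (Real.exp (2 * K * t) * (2 * K)) t :=
    fun t ↦ by
      have h1 : HasDerivAt (fun s : ℝ ↦ 2 * K * s) (2 * K) t := by
        simpa using (hasDerivAt_id t).const_mul (2 * K)
      exact h1.exp
  have hhd : ∀ t ∈ Ioi (0 : ℝ), HasDerivAt h (Real.exp (2 * K * t) * (2 * K) * If t
      + Real.exp (2 * K * t) * ∫ y, derivWithin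
        (fun s ↦ g.gradSq (f s) y * Real.exp (-f s y) * Real.exp (-V y)) (Ici 0) t ∂g.riemVolume) t :=
    fun t ht ↦ (hexpd t).mul (hId t ht)
  have hanti : AntitoneOn h (Ici 0) := by
    refine antitoneOn_of_deriv_nonpos (convex_Ici 0) hhc ?_ ?_
    · rw [interior_Ici]
      exact fun t ht ↦ (hhd t ht).differentiableAt.differentiableWithinAt
    · rw [interior_Ici]
      intro t ht
      rw [(hhd t ht).deriv]
      have hpos : 0 < Real.exp (2 * K * t) := Real.exp_pos _
      nlinarith [hI'le t ht, hpos]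
  have hmono := hanti (self_mem_Ici (a := (0 : ℝ))) (show T ∈ Ici (0 : ℝ) from hT) hT
  -- unfold
  have h0 : h 0 = If 0 := by simp [hhdef]
  have hTval : h T = Real.exp (2 * K * T) * If T := rfl
  rw [h0, hTval] at hmono
  have hexp : Real.exp (-2 * K * T) * (Real.exp (2 * K * T) * If T) = If T := by
    rw [← mul_assoc, ← Real.exp_add, show -2 * K * T + 2 * K * T = 0 by ring, Real.exp_zero,
      one_mul]
  calc If T = Real.exp (-2 * K * T) * (Real.exp (2 * K * T) * If T) := hexp.symm
    _ ≤ Real.exp (-2 * K * T) * If 0 :=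
        mul_le_mul_of_nonneg_left hmono (Real.exp_pos _).le

omit [I.Boundaryless] [CompactSpace M] [T3Space M] [MeasurableSpace M] [BorelSpace M]
  [FiniteDimensional ℝ E] [g.HasLeviCivita] [IsManifold I ∞ M] in
/-- `d(e^{-F}(F − 1)) = e^{-F}(2 − F) dF` as linear maps. [folklore] -/
theorem mvfderiv_exp_neg_mul_sub_one_toLinearMap {F : M → ℝ} {x : M}
    (hF : MDifferentiableAt I 𝓘(ℝ, ℝ) F x) :
    (mvfderiv I (fun y ↦ Real.exp (-F y) * (F y - 1)) x : TangentSpace I x →ₗ[ℝ] ℝ) =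
      (Real.exp (-F x) * (2 - F x)) • (mvfderiv I F x : TangentSpace I x →ₗ[ℝ] ℝ) := by
  have hE : MDifferentiableAt I 𝓘(ℝ, ℝ) (fun y ↦ Real.exp (-F y)) x :=
    ((Real.differentiable_exp.comp differentiable_neg).differentiableAt
      (x := F x)).comp_mdifferentiableAt hF
  have hS1 : MDifferentiableAt I 𝓘(ℝ, ℝ) (fun y ↦ F y - 1) x :=
    ((differentiable_id.sub_const (1 : ℝ)).differentiableAt (x := F x)).comp_mdifferentiableAt hF
  have hd1 : ∀ v, mvfderiv I (fun y ↦ F y - 1) x v = mvfderiv I F x v := fun v ↦ by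
    have h := mvfderiv_real_comp_apply (I := I) ((hasDerivAt_id (F x)).sub_const (1 : ℝ)) hF v
    rw [one_mul] at h
    exact h
  have hd2 : ∀ v, mvfderiv I (fun y ↦ Real.exp (-F y)) x v = -Real.exp (-F x) * mvfderiv I F x v := by
    intro v
    have h1 : HasDerivAt (fun t : ℝ ↦ Real.exp (-t)) (-Real.exp (-F x)) (F x) := by
      simpa using (hasDerivAt_neg (F x)).exp
    exact mvfderiv_real_comp_apply (I := I) h1 hF v
  ext v
  have hmul := mvfderiv_fun_mul hE hS1
  simp only [ContinuousLinearMap.coe_coe, LinearMap.smul_apply, smul_eq_mul]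
  rw [hmul]
  simp only [add_apply, smul_apply, smul_eq_mul, hd1 v, hd2 v]
  ring

/-- **The entropy dissipates at the rate of the Fisher information: `d/dt H = −I`**
(Carrillo–Ni 2009, §3, (3.2): "`d/dt H_V(ρ(t)) = −∫ |∇ξ|²ρ dΓ = −I_V(ρ(t))`"). Under the hypotheses of
`fisher_le_exp_mul`, the entropy `H(t) = ∫_M (−f) e^{-f} e^{-V} dV_g` of `u = e^{-f}` with respect to
`dm = e^{-V}dV_g` has derivative `−I(t)` at every `t > 0`. Proof: Leibniz rule, `∂ₜ((−f)e^{-f}) =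
(∂ₜf)(f − 1)e^{-f} = (Lf − |∇f|²)(f − 1)e^{-f}`, and `∫ (Lf) e^{-f}(f − 1) dm = −∫ ⟨d(e^{-f}(f−1)), df⟩ dm
= ∫ (f − 2)|∇f|² e^{-f} dm` (weighted Green). [cite: CarrilloNi2009, §3, (3.2)] -/
theorem hasDerivAt_entropy (hR : g.IsRiemannian) {V : M → ℝ}
    (hV : ContMDiff I 𝓘(ℝ, ℝ) ∞ V) {f : ℝ → M → ℝ}
    (hf : ContMDiffOn (I.prod 𝓘(ℝ, ℝ)) 𝓘(ℝ, ℝ) ∞ (fun p : M × ℝ ↦ f p.2 p.1) (univ ×ˢ Ici 0))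
    (heq : ∀ t ∈ Ici (0 : ℝ), ∀ y : M, derivWithin (fun s ↦ f s y) (Ici 0) t =
      g.dalembertian (f t) y
        - g.innerDual y (mvfderiv I V y : TangentSpace I y →ₗ[ℝ] ℝ)
            (mvfderiv I (f t) y : TangentSpace I y →ₗ[ℝ] ℝ)
        - g.gradSq (f t) y)
    {t : ℝ} (ht : 0 < t) :
    HasDerivAt (fun s ↦ ∫ y, (-f s y) * Real.exp (-f s y) * Real.exp (-V y) ∂g.riemVolume)
      (-∫ y, g.gradSq (f t) y * Real.exp (-f t y) * Real.exp (-V y) ∂g.riemVolume) t := by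
  haveI : IsFiniteMeasure g.riemVolume := ⟨g.riemVolume_univ_lt_top⟩
  have hS : UniqueDiffOn ℝ (Ici (0 : ℝ)) := uniqueDiffOn_Ici 0
  have htS : t ∈ Ici (0 : ℝ) := le_of_lt ht
  -- the family `(−f) e^{-f} e^{-V}` and its time derivative
  have hRfam : ContMDiffOn (I.prod 𝓘(ℝ, ℝ)) 𝓘(ℝ, ℝ) ∞
      (fun p : M × ℝ ↦ (-f p.2 p.1) * Real.exp (-f p.2 p.1) * Real.exp (-V p.1))
      (univ ×ˢ Ici 0) := by
    have hu : ContMDiffOn (I.prod 𝓘(ℝ, ℝ)) 𝓘(ℝ, ℝ) ∞ (fun p : M × ℝ ↦ Real.exp (-f p.2 p.1))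
        (univ ×ˢ Ici 0) := (Real.contDiff_exp.comp contDiff_neg).contMDiff.comp_contMDiffOn hf
    have hw : ContMDiffOn (I.prod 𝓘(ℝ, ℝ)) 𝓘(ℝ, ℝ) ∞ (fun p : M × ℝ ↦ Real.exp (-V p.1))
        (univ ×ˢ Ici 0) :=
      ((Real.contDiff_exp.comp contDiff_neg).comp_contMDiff (hV.comp contMDiff_fst)).contMDiffOn
    exact (hf.neg.mul hu).mul hw
  have hR'fam := contMDiffOn_derivWithin_time_of_uniqueDiffOn
    (u := fun s y ↦ (-f s y) * Real.exp (-f s y) * Real.exp (-V y)) hS hRfam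
  have ht' : t ∈ interior (Ici (0 : ℝ)) := by rw [interior_Ici]; exact ht
  have hmain := hasDerivAt_integral_of_continuousOn_prod g.riemVolume hRfam.continuousOn
    hR'fam.continuousOn
    (fun y s hs ↦ hasDerivWithinAt_time_of_contMDiffOn (k := ∞)
      (u := fun s y ↦ (-f s y) * Real.exp (-f s y) * Real.exp (-V y)) (by simp) hRfam y hs) ht'
  refine hmain.congr_deriv ?_
  -- the value of the derivative
  have hF : ContMDiff I 𝓘(ℝ, ℝ) ∞ (f t) :=
    hf.comp_contMDiff (contMDiff_id.prodMk contMDiff_const) fun y ↦ ⟨mem_univ _, htS⟩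
  have hF1 : ContMDiff I 𝓘(ℝ, ℝ) 1 (f t) := hF.of_le (by norm_num)
  have hF2 : ContMDiff I 𝓘(ℝ, ℝ) 2 (f t) := hF.of_le (WithTop.coe_le_coe.mpr le_top)
  have hV1 : ContMDiff I 𝓘(ℝ, ℝ) 1 V := hV.of_le (by norm_num)
  have hfd : ∀ y, HasDerivWithinAt (fun s ↦ f s y) (derivWithin (fun s ↦ f s y) (Ici 0) t)
      (Ici 0) t := fun y ↦ hasDerivWithinAt_time_of_contMDiffOn (by simp) hf y htS
  -- pointwise: `∂ₜ((−f)e^{-f}e^{-V}) = ḟ (f − 1) e^{-f} e^{-V}`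
  have hpt : ∀ y, derivWithin (fun s ↦ (-f s y) * Real.exp (-f s y) * Real.exp (-V y)) (Ici 0) t =
      derivWithin (fun s ↦ f s y) (Ici 0) t * (f t y - 1) * Real.exp (-f t y) * Real.exp (-V y) := by
    intro y
    have hu : HasDerivWithinAt (fun s ↦ Real.exp (-f s y))
        (Real.exp (-f t y) * -(derivWithin (fun s ↦ f s y) (Ici 0) t)) (Ici 0) t :=
      ((hfd y).neg).exp
    have h1 : HasDerivWithinAt (fun s ↦ (-f s y) * Real.exp (-f s y))
        (-(derivWithin (fun s ↦ f s y) (Ici 0) t) * Real.exp (-f t y)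
          + (-f t y) * (Real.exp (-f t y) * -(derivWithin (fun s ↦ f s y) (Ici 0) t))) (Ici 0) t :=
      (hfd y).neg.mul hu
    have h := (h1.mul_const (Real.exp (-V y))).derivWithin (hS t htS)
    rw [h]
    ring
  -- the Green computation
  have ha1 : ContMDiff I 𝓘(ℝ, ℝ) 1 (fun y ↦ Real.exp (-f t y) * (f t y - 1)) :=
    (((Real.contDiff_exp.comp contDiff_neg).comp_contMDiff hF).mul
      (hF.sub contMDiff_const)).of_le (by norm_num)
  have hG := integral_mul_weightedLaplacian g hR ha1 hF2 hV1
  have hda : ∀ y, g.innerDual y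
      (mvfderiv I (fun y ↦ Real.exp (-f t y) * (f t y - 1)) y : TangentSpace I y →ₗ[ℝ] ℝ)
      (mvfderiv I (f t) y : TangentSpace I y →ₗ[ℝ] ℝ) =
      Real.exp (-f t y) * (2 - f t y) * g.gradSq (f t) y := fun y ↦ by
    rw [mvfderiv_exp_neg_mul_sub_one_toLinearMap (hF1.mdifferentiableAt one_ne_zero),
      g.innerDual_smul_left]
    rfl
  -- continuity / integrability
  have hQc : Continuous (g.gradSq (f t)) := (contMDiff_gradSq g hF).continuous
  have hΔFc : Continuous (g.dalembertian (f t)) := continuous_dalembertian g hF2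
  have hIVF : Continuous fun y ↦ g.innerDual y (mvfderiv I V y : TangentSpace I y →ₗ[ℝ] ℝ)
      (mvfderiv I (f t) y : TangentSpace I y →ₗ[ℝ] ℝ) := continuous_innerDual_mvfderiv g hV1 hF1
  have hUc : Continuous fun y ↦ Real.exp (-f t y) :=
    Real.continuous_exp.comp hF.continuous.neg
  have hWc : Continuous fun y ↦ Real.exp (-V y) := Real.continuous_exp.comp hV.continuous.neg
  have hFc : Continuous (f t) := hF.continuous
  have iB1 : Integrable (fun y ↦ (Real.exp (-f t y) * (f t y - 1)) * (g.dalembertian (f t) y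
      - g.innerDual y (mvfderiv I V y : TangentSpace I y →ₗ[ℝ] ℝ)
          (mvfderiv I (f t) y : TangentSpace I y →ₗ[ℝ] ℝ)) * Real.exp (-V y)) g.riemVolume :=
    g.integrable_of_continuous (((hUc.mul (hFc.sub continuous_const)).mul (hΔFc.sub hIVF)).mul hWc)
  have iB2 : Integrable (fun y ↦ g.gradSq (f t) y * (f t y - 1) * Real.exp (-f t y) * Real.exp (-V y))
      g.riemVolume := g.integrable_of_continuous (((hQc.mul (hFc.sub continuous_const)).mul hUc).mul hWc)
  have iB3 : Integrable (fun y ↦ g.gradSq (f t) y * f t y * Real.exp (-f t y) * Real.exp (-V y))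
      g.riemVolume := g.integrable_of_continuous (((hQc.mul hFc).mul hUc).mul hWc)
  have iB4 : Integrable (fun y ↦ g.gradSq (f t) y * Real.exp (-f t y) * Real.exp (-V y))
      g.riemVolume := g.integrable_of_continuous ((hQc.mul hUc).mul hWc)
  -- assemble
  have s1 : ∫ y, derivWithin (fun s ↦ (-f s y) * Real.exp (-f s y) * Real.exp (-V y)) (Ici 0) t
      ∂g.riemVolume =
      ∫ y, ((Real.exp (-f t y) * (f t y - 1)) * (g.dalembertian (f t) y
        - g.innerDual y (mvfderiv I V y : TangentSpace I y →ₗ[ℝ] ℝ)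
            (mvfderiv I (f t) y : TangentSpace I y →ₗ[ℝ] ℝ)) * Real.exp (-V y)
        - g.gradSq (f t) y * (f t y - 1) * Real.exp (-f t y) * Real.exp (-V y)) ∂g.riemVolume := by
    refine integral_congr_ae (Filter.Eventually.of_forall fun y ↦ ?_)
    dsimp only
    rw [hpt y, heq t htS y]
    ring
  have s2 : ∫ y, ((Real.exp (-f t y) * (f t y - 1)) * (g.dalembertian (f t) y
        - g.innerDual y (mvfderiv I V y : TangentSpace I y →ₗ[ℝ] ℝ)
            (mvfderiv I (f t) y : TangentSpace I y →ₗ[ℝ] ℝ)) * Real.exp (-V y)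
        - g.gradSq (f t) y * (f t y - 1) * Real.exp (-f t y) * Real.exp (-V y)) ∂g.riemVolume =
      ∫ y, (Real.exp (-f t y) * (f t y - 1)) * (g.dalembertian (f t) y
        - g.innerDual y (mvfderiv I V y : TangentSpace I y →ₗ[ℝ] ℝ)
            (mvfderiv I (f t) y : TangentSpace I y →ₗ[ℝ] ℝ)) * Real.exp (-V y) ∂g.riemVolume
      - ∫ y, g.gradSq (f t) y * (f t y - 1) * Real.exp (-f t y) * Real.exp (-V y) ∂g.riemVolume :=
    integral_sub iB1 iB2
  have s3 : ∫ y, g.innerDual y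
      (mvfderiv I (fun y ↦ Real.exp (-f t y) * (f t y - 1)) y : TangentSpace I y →ₗ[ℝ] ℝ)
      (mvfderiv I (f t) y : TangentSpace I y →ₗ[ℝ] ℝ) * Real.exp (-V y) ∂g.riemVolume =
      ∫ y, (2 * (g.gradSq (f t) y * Real.exp (-f t y) * Real.exp (-V y))
        - g.gradSq (f t) y * f t y * Real.exp (-f t y) * Real.exp (-V y)) ∂g.riemVolume := by
    refine integral_congr_ae (Filter.Eventually.of_forall fun y ↦ ?_)
    dsimp only
    rw [hda y]
    ring
  have s4 : ∫ y, (2 * (g.gradSq (f t) y * Real.exp (-f t y) * Real.exp (-V y))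
        - g.gradSq (f t) y * f t y * Real.exp (-f t y) * Real.exp (-V y)) ∂g.riemVolume =
      ∫ y, 2 * (g.gradSq (f t) y * Real.exp (-f t y) * Real.exp (-V y)) ∂g.riemVolume
      - ∫ y, g.gradSq (f t) y * f t y * Real.exp (-f t y) * Real.exp (-V y) ∂g.riemVolume :=
    integral_sub (iB4.const_mul 2) iB3
  have s5 : ∫ y, 2 * (g.gradSq (f t) y * Real.exp (-f t y) * Real.exp (-V y)) ∂g.riemVolume =
      2 * ∫ y, g.gradSq (f t) y * Real.exp (-f t y) * Real.exp (-V y) ∂g.riemVolume :=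
    integral_const_mul 2 _
  have s6 : ∫ y, g.gradSq (f t) y * (f t y - 1) * Real.exp (-f t y) * Real.exp (-V y) ∂g.riemVolume =
      ∫ y, (g.gradSq (f t) y * f t y * Real.exp (-f t y) * Real.exp (-V y)
        - g.gradSq (f t) y * Real.exp (-f t y) * Real.exp (-V y)) ∂g.riemVolume :=
    integral_congr_ae (Filter.Eventually.of_forall fun y ↦ by ring)
  have s7 : ∫ y, (g.gradSq (f t) y * f t y * Real.exp (-f t y) * Real.exp (-V y)
        - g.gradSq (f t) y * Real.exp (-f t y) * Real.exp (-V y)) ∂g.riemVolume =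
      ∫ y, g.gradSq (f t) y * f t y * Real.exp (-f t y) * Real.exp (-V y) ∂g.riemVolume
      - ∫ y, g.gradSq (f t) y * Real.exp (-f t y) * Real.exp (-V y) ∂g.riemVolume :=
    integral_sub iB3 iB4
  linarith [s1, s2, s3, s4, s5, s6, s7, hG]

/-- **The Bakry–Émery inequality along the flow: `H(0) ≤ I(0)/(2K)` given `H(T) → 0`**
(Carrillo–Ni 2009, §3: integrating `dH/dt = −I` with `I(t) ≤ e^{−2Kt}I(0)`; Bakry–Émery 1985).
Hypotheses as in `fisher_le_exp_mul`, with `K > 0` and the ergodicity `H(T) → 0` (`T → ∞`).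
Proof: `m(t) = H(t) − (I(0)/2K) e^{−2Kt}` has derivative `−I(t) + I(0)e^{−2Kt} ≥ 0` on `(0, ∞)`
and is continuous on `[0, ∞)`, hence nondecreasing, so `H(0) − I(0)/2K ≤ H(T) − (I(0)/2K)e^{−2KT}
≤ H(T) → 0`. [cite: CarrilloNi2009, §3 (3.2) and p. 8] -/
theorem entropy_le_fisher_div (hR : g.IsRiemannian) {V : M → ℝ} {K : ℝ} (hK : 0 < K)
    (hV : ContMDiff I 𝓘(ℝ, ℝ) ∞ V)
    (hRic : ∀ (y : M) (X : TangentSpace I y), K * g.val y X X ≤ g.ricci y X X + g.hessian V y X X)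
    {f : ℝ → M → ℝ}
    (hf : ContMDiffOn (I.prod 𝓘(ℝ, ℝ)) 𝓘(ℝ, ℝ) ∞ (fun p : M × ℝ ↦ f p.2 p.1) (univ ×ˢ Ici 0))
    (heq : ∀ t ∈ Ici (0 : ℝ), ∀ y : M, derivWithin (fun s ↦ f s y) (Ici 0) t =
      g.dalembertian (f t) y
        - g.innerDual y (mvfderiv I V y : TangentSpace I y →ₗ[ℝ] ℝ)
            (mvfderiv I (f t) y : TangentSpace I y →ₗ[ℝ] ℝ)
        - g.gradSq (f t) y)
    (hlim : Filter.Tendsto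
      (fun s ↦ ∫ y, (-f s y) * Real.exp (-f s y) * Real.exp (-V y) ∂g.riemVolume)
      Filter.atTop (𝓝 0)) :
    ∫ y, (-f 0 y) * Real.exp (-f 0 y) * Real.exp (-V y) ∂g.riemVolume ≤
      1 / (2 * K) * ∫ y, g.gradSq (f 0) y * Real.exp (-f 0 y) * Real.exp (-V y) ∂g.riemVolume := by
  haveI : IsFiniteMeasure g.riemVolume := ⟨g.riemVolume_univ_lt_top⟩
  have hS : UniqueDiffOn ℝ (Ici (0 : ℝ)) := uniqueDiffOn_Ici 0
  set I₀ : ℝ := ∫ y, g.gradSq (f 0) y * Real.exp (-f 0 y) * Real.exp (-V y) ∂g.riemVolume with hI₀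
  set Hf : ℝ → ℝ := fun s ↦ ∫ y, (-f s y) * Real.exp (-f s y) * Real.exp (-V y) ∂g.riemVolume
    with hHfdef
  have hI₀nn : 0 ≤ I₀ := integral_nonneg fun y ↦
    mul_nonneg (mul_nonneg (g.gradSq_nonneg hR _ y) (Real.exp_pos _).le) (Real.exp_pos _).le
  -- continuity of `H` on `[0, ∞)`
  have hRfam : ContMDiffOn (I.prod 𝓘(ℝ, ℝ)) 𝓘(ℝ, ℝ) ∞
      (fun p : M × ℝ ↦ (-f p.2 p.1) * Real.exp (-f p.2 p.1) * Real.exp (-V p.1))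
      (univ ×ˢ Ici 0) := by
    have hu : ContMDiffOn (I.prod 𝓘(ℝ, ℝ)) 𝓘(ℝ, ℝ) ∞ (fun p : M × ℝ ↦ Real.exp (-f p.2 p.1))
        (univ ×ˢ Ici 0) := (Real.contDiff_exp.comp contDiff_neg).contMDiff.comp_contMDiffOn hf
    have hw : ContMDiffOn (I.prod 𝓘(ℝ, ℝ)) 𝓘(ℝ, ℝ) ∞ (fun p : M × ℝ ↦ Real.exp (-V p.1))
        (univ ×ˢ Ici 0) :=
      ((Real.contDiff_exp.comp contDiff_neg).comp_contMDiff (hV.comp contMDiff_fst)).contMDiffOn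
    exact (hf.neg.mul hu).mul hw
  have hHc : ContinuousOn Hf (Ici 0) :=
    continuousOn_integral_of_continuousOn_prod g.riemVolume isClosed_Ici hRfam.continuousOn
  -- `m(t) = H(t) − (I₀/2K) e^{−2Kt}` is nondecreasing
  set m : ℝ → ℝ := fun s ↦ Hf s - I₀ / (2 * K) * Real.exp (-2 * K * s) with hmdef
  have hexpd : ∀ t : ℝ, HasDerivAt (fun s ↦ Real.exp (-2 * K * s)) (Real.exp (-2 * K * t) * (-2 * K)) t :=
    fun t ↦ by
      have h1 : HasDerivAt (fun s : ℝ ↦ -2 * K * s) (-2 * K) t := by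
        simpa using (hasDerivAt_id t).const_mul (-2 * K)
      exact h1.exp
  have hmc : ContinuousOn m (Ici 0) :=
    hHc.sub (continuousOn_const.mul
      (Real.continuous_exp.comp (continuous_const.mul continuous_id)).continuousOn)
  have hmd : ∀ t ∈ Ioi (0 : ℝ), HasDerivAt m
      (-(∫ y, g.gradSq (f t) y * Real.exp (-f t y) * Real.exp (-V y) ∂g.riemVolume)
        - I₀ / (2 * K) * (Real.exp (-2 * K * t) * (-2 * K))) t := fun t ht ↦
    (hasDerivAt_entropy g hR hV hf heq (Set.mem_Ioi.1 ht)).sub ((hexpd t).const_mul _)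
  have hmono : MonotoneOn m (Ici 0) := by
    refine monotoneOn_of_deriv_nonneg (convex_Ici 0) hmc ?_ ?_
    · rw [interior_Ici]
      exact fun t ht ↦ (hmd t ht).differentiableAt.differentiableWithinAt
    · rw [interior_Ici]
      intro t ht
      rw [(hmd t ht).deriv]
      have hdecay := fisher_le_exp_mul g hR hV hRic hf heq (le_of_lt (Set.mem_Ioi.1 ht))
      have hK' : I₀ / (2 * K) * (Real.exp (-2 * K * t) * (-2 * K)) = -(Real.exp (-2 * K * t) * I₀) := by
        field_simp
      rw [hK']
      linarith
  -- `H(0) − I₀/2K ≤ H(T)` for all `T ≥ 0`, and `H(T) → 0`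
  have hle : ∀ T : ℝ, 0 ≤ T → Hf 0 - I₀ / (2 * K) ≤ Hf T := by
    intro T hT
    have h := hmono (self_mem_Ici (a := (0 : ℝ))) (show T ∈ Ici (0 : ℝ) from hT) hT
    have h0 : m 0 = Hf 0 - I₀ / (2 * K) := by simp [hmdef]
    have hT' : m T ≤ Hf T := by
      have : 0 ≤ I₀ / (2 * K) * Real.exp (-2 * K * T) :=
        mul_nonneg (div_nonneg hI₀nn (by linarith)) (Real.exp_pos _).le
      simp only [hmdef]
      linarith
    linarith
  have hev : ∀ᶠ T in Filter.atTop, Hf 0 - I₀ / (2 * K) ≤ Hf T :=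
    Filter.eventually_atTop.2 ⟨0, fun T hT ↦ hle T hT⟩
  have hfin := ge_of_tendsto hlim hev
  have : Hf 0 ≤ I₀ / (2 * K) := by linarith
  calc Hf 0 ≤ I₀ / (2 * K) := this
    _ = 1 / (2 * K) * I₀ := by ring

end Decay

end Literature.Geometry.Riemannian


/-! ## PART 6 — from the weighted heat flow to the Bakry–Émery inequality, and the assembly -/

namespace Literature.Geometry.Riemannian

open Lorentzian Lorentzian.PseudoRiemannianMetric _root_.MeasureTheory

universe u

section HeatFlow

variable {E : Type*} [NormedAddCommGroup E] [NormedSpace ℝ E] [FiniteDimensional ℝ E]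
  {H : Type*} [TopologicalSpace H] {I : ModelWithCorners ℝ E H} [I.Boundaryless]
  {M : Type*} [TopologicalSpace M] [ChartedSpace H M] [IsManifold I ∞ M]
  [CompactSpace M] [T3Space M] [MeasurableSpace M] [BorelSpace M]
  (g : PseudoRiemannianMetric I ∞ E (TangentSpace I : M → Type _)) [g.HasLeviCivita]

/-- `|x log x| ≤ 3|x − 1|` for `|x − 1| ≤ 1/2` (`1 − 1/x ≤ log x ≤ x − 1`). [folklore] -/
theorem abs_mul_log_le {x : ℝ} (hx : |x - 1| ≤ 1 / 2) : |x * Real.log x| ≤ 3 * |x - 1| := by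
  have hx1 : 1 / 2 ≤ x := by
    have := neg_le_of_abs_le hx; linarith
  have hx2 : x ≤ 3 / 2 := by
    have := le_of_abs_le hx; linarith
  have hpos : 0 < x := by linarith
  have hup : Real.log x ≤ x - 1 := Real.log_le_sub_one_of_pos hpos
  have hlow : 1 - x⁻¹ ≤ Real.log x := Real.one_sub_inv_le_log_of_pos hpos
  have hinv : 1 - x⁻¹ ≥ -2 * |x - 1| := by
    have h2 : x⁻¹ ≤ 2 := by rw [inv_le_comm₀ hpos (by norm_num)]; linarith
    rcases le_or_gt 1 x with h | h
    · have : x⁻¹ ≤ 1 := inv_le_one_of_one_le₀ h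
      have : 0 ≤ |x - 1| := abs_nonneg _
      linarith
    · have hx1' : 1 - x⁻¹ = -(1 - x) * x⁻¹ := by field_simp; ring
      rw [hx1', abs_of_neg (by linarith : x - 1 < 0)]
      nlinarith [inv_pos.2 hpos]
  have hlogabs : |Real.log x| ≤ 2 * |x - 1| := by
    rw [abs_le]
    constructor
    · linarith
    · linarith [le_abs_self (x - 1)]
  calc |x * Real.log x| = |x| * |Real.log x| := abs_mul _ _
    _ ≤ (3 / 2) * (2 * |x - 1|) := by
        refine mul_le_mul ?_ hlogabs (abs_nonneg _) (by norm_num)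
        rw [abs_of_pos hpos]; exact hx2
    _ = 3 * |x - 1| := by ring

omit [I.Boundaryless] [g.HasLeviCivita] in
/-- **The entropy of a flow converging uniformly to `1` tends to `0`**: if `u(t, ·) → 1`
uniformly and `∫ e^{-V} dV_g = 1`, then `∫ u log u e^{-V} dV_g → 0` (`|x log x| ≤ 3|x − 1|` near
`1`). [folklore] -/
theorem tendsto_entropy_of_tendstoUniformly {V : M → ℝ} (hV : ContMDiff I 𝓘(ℝ, ℝ) ∞ V)
    (hmass : ∫ x, Real.exp (-V x) ∂g.riemVolume = 1) {u : ℝ → M → ℝ}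
    (hu : ∀ t ∈ Ici (0 : ℝ), Continuous (u t))
    (hlim : TendstoUniformly (fun t ↦ u t) (fun _ ↦ (1 : ℝ)) Filter.atTop) :
    Filter.Tendsto (fun t ↦ ∫ x, u t x * Real.log (u t x) * Real.exp (-V x) ∂g.riemVolume)
      Filter.atTop (𝓝 0) := by
  have hWc : Continuous fun x ↦ Real.exp (-V x) := Real.continuous_exp.comp hV.continuous.neg
  rw [Metric.tendsto_atTop]
  intro ε hε
  set δ : ℝ := min (ε / 6) (1 / 2) with hδ
  have hδpos : 0 < δ := lt_min (by linarith) (by norm_num)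
  have hev := (Metric.tendstoUniformly_iff.1 hlim) δ hδpos
  obtain ⟨N, hN⟩ := Filter.eventually_atTop.1 hev
  refine ⟨max N 0, fun t ht ↦ ?_⟩
  have htN : N ≤ t := le_trans (le_max_left _ _) ht
  have ht0 : t ∈ Ici (0 : ℝ) := le_trans (le_max_right _ _) ht
  have hclose : ∀ x, |u t x - 1| ≤ δ := fun x ↦ by
    have h := hN t htN x
    rw [Real.dist_eq, abs_sub_comm] at h
    exact h.le
  have hpt : ∀ x, |u t x * Real.log (u t x) * Real.exp (-V x)| ≤ 3 * δ * Real.exp (-V x) := by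
    intro x
    have h1 : |u t x - 1| ≤ 1 / 2 := (hclose x).trans (min_le_right _ _)
    rw [abs_mul, abs_of_pos (Real.exp_pos _)]
    refine mul_le_mul_of_nonneg_right ?_ (Real.exp_pos _).le
    exact (abs_mul_log_le h1).trans (by nlinarith [hclose x])
  have hint : Integrable (fun x ↦ u t x * Real.log (u t x) * Real.exp (-V x)) g.riemVolume := by
    refine g.integrable_of_continuous ((?_ : Continuous fun x ↦ u t x * Real.log (u t x)).mul hWc)
    have hpos : ∀ x, 0 < u t x := fun x ↦ by
      have := neg_le_of_abs_le ((hclose x).trans (min_le_right _ _)); linarith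
    exact (hu t ht0).mul ((hu t ht0).log fun x ↦ (hpos x).ne')
  rw [Real.dist_eq, sub_zero]
  calc |∫ x, u t x * Real.log (u t x) * Real.exp (-V x) ∂g.riemVolume|
      ≤ ∫ x, |u t x * Real.log (u t x) * Real.exp (-V x)| ∂g.riemVolume := by
        rw [← Real.norm_eq_abs]
        exact (norm_integral_le_integral_norm _).trans (le_of_eq rfl)
    _ ≤ ∫ x, 3 * δ * Real.exp (-V x) ∂g.riemVolume :=
        integral_mono hint.abs (g.integrable_of_continuous (continuous_const.mul hWc)) hpt
    _ = 3 * δ := by rw [integral_const_mul, hmass, mul_one]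
    _ < ε := by
        have : δ ≤ ε / 6 := min_le_left _ _
        linarith

omit [CompactSpace M] [T3Space M] [MeasurableSpace M] [BorelSpace M] [I.Boundaryless] in
/-- **`−log` of a positive solution of the weighted heat equation solves `∂ₜf = Lf − |∇f|²`**:
for `u(t, ·) > 0` with `∂ₜu = Δu − g⁻¹(dV, du)`, the function `f = −log u` satisfies
`∂ₜf = (Δf − g⁻¹(dV, df)) − |∇f|²` (chain rules `Δ(ζ∘u) = ζ''|∇u|² + ζ'Δu`,
`|∇(ζ∘u)|² = ζ'²|∇u|²`, `d(ζ∘u) = ζ' du` with `ζ = −log`). [cite: CarrilloNi2009, §3 (3.1)] -/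
theorem negLog_heat_equation {V : M → ℝ} {u : ℝ → M → ℝ} {S : Set ℝ} {t : ℝ} {x : M}
    (hut : ContMDiffAt I 𝓘(ℝ, ℝ) 2 (u t) x) (hpos : 0 < u t x)
    (hd : HasDerivWithinAt (fun s ↦ u s x) (derivWithin (fun s ↦ u s x) S t) S t)
    (hUS : UniqueDiffWithinAt ℝ S t)
    (heq : derivWithin (fun s ↦ u s x) S t =
      g.dalembertian (u t) x - g.innerDual x (mvfderiv I V x : TangentSpace I x →ₗ[ℝ] ℝ)
        (mvfderiv I (u t) x : TangentSpace I x →ₗ[ℝ] ℝ)) :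
    derivWithin (fun s ↦ -Real.log (u s x)) S t =
      g.dalembertian (fun y ↦ -Real.log (u t y)) x
        - g.innerDual x (mvfderiv I V x : TangentSpace I x →ₗ[ℝ] ℝ)
            (mvfderiv I (fun y ↦ -Real.log (u t y)) x : TangentSpace I x →ₗ[ℝ] ℝ)
        - g.gradSq (fun y ↦ -Real.log (u t y)) x := by
  have hne : u t x ≠ 0 := hpos.ne'
  have hud : MDifferentiableAt I 𝓘(ℝ, ℝ) (u t) x := hut.mdifferentiableAt (by norm_num)
  -- the time derivative of `−log u`
  have h1 : HasDerivWithinAt (fun s ↦ -Real.log (u s x))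
      (-(derivWithin (fun s ↦ u s x) S t / u t x)) S t := (hd.log hne).neg
  rw [h1.derivWithin hUS, heq]
  -- the chain rules with `ζ = −log`
  have hζ : ContDiffAt ℝ 2 (fun s : ℝ ↦ -Real.log s) (u t x) := (Real.contDiffAt_log.2 hne).neg
  have hζ' : ∀ {s : ℝ}, s ≠ 0 → HasDerivAt (fun r : ℝ ↦ -Real.log r) (-s⁻¹) s := fun hs ↦
    (Real.hasDerivAt_log hs).neg
  have hd1 : deriv (fun r : ℝ ↦ -Real.log r) (u t x) = -(u t x)⁻¹ := (hζ' hne).deriv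
  have hd2 : deriv (deriv fun r : ℝ ↦ -Real.log r) (u t x) = ((u t x) ^ 2)⁻¹ := by
    have hev : deriv (fun r : ℝ ↦ -Real.log r) =ᶠ[𝓝 (u t x)] fun r ↦ -r⁻¹ := by
      filter_upwards [isOpen_ne.mem_nhds hne] with r hr
      exact (hζ' hr).deriv
    rw [hev.deriv_eq]
    have h : HasDerivAt (fun r : ℝ ↦ -r⁻¹) (-(-((u t x) ^ 2)⁻¹)) (u t x) :=
      (hasDerivAt_inv hne).neg
    rw [h.deriv]
    ring
  have hΔ := g.dalembertian_real_comp (ζ := fun s : ℝ ↦ -Real.log s) hut hζ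
  have hfun : (fun y ↦ -Real.log (u t y)) = (fun s : ℝ ↦ -Real.log s) ∘ u t := rfl
  have hgrad : g.gradSq ((fun s : ℝ ↦ -Real.log s) ∘ u t) x = (-(u t x)⁻¹) ^ 2 * g.gradSq (u t) x :=
    g.gradSq_real_comp (hζ' hne) hud
  have hdf : (mvfderiv I ((fun s : ℝ ↦ -Real.log s) ∘ u t) x : TangentSpace I x →ₗ[ℝ] ℝ) =
      (-(u t x)⁻¹) • (mvfderiv I (u t) x : TangentSpace I x →ₗ[ℝ] ℝ) := by
    ext v
    simp only [ContinuousLinearMap.coe_coe, LinearMap.smul_apply, smul_eq_mul]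
    exact mvfderiv_real_comp_apply (I := I) (hζ' hne) hud v
  have hgq : g.innerDual x (mvfderiv I (u t) x).toLinearMap (mvfderiv I (u t) x).toLinearMap =
      g.gradSq (u t) x := rfl
  rw [hfun, hΔ, hd1, hd2, hgrad, hdf, g.innerDual_smul_right, hgq]
  field_simp
  ring

/-- **The Bakry–Émery logarithmic Sobolev inequality from the weighted heat flow** (the
"Bakry–Émery strategy" recalled by Carrillo–Ni 2009, §3, pp. 7–8; Bakry–Émery 1985). Let `g` be
Riemannian on a closed manifold (any model), `V` smooth with `Ric + Hess V ≥ K g`, `K > 0`,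
`∫ e^{-V} dV_g = 1`. ASSUME the weighted heat flow: every smooth positive `h₀` is the initial
value of a `u` smooth on `M × [0, ∞)`, positive, solving `∂ₜu = Δu − g⁻¹(dV, du)`, with
`u(t, ·) → ∫ h₀ e^{-V} dV_g` uniformly as `t → ∞` (hypothesis `hflow`). Then for every smooth `φ`
with `∫ e^φ e^{-V} dV_g = 1`: `∫ φ e^φ e^{-V} dV_g ≤ (1/2K) ∫ |∇φ|² e^φ e^{-V} dV_g`.
Proof: `f = −log u` for the flow from `h₀ = e^φ` solves `∂ₜf = Lf − |∇f|²`
(`negLog_heat_equation`), `H(t) → 0` (`tendsto_entropy_of_tendstoUniformly`), and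
`entropy_le_fisher_div` gives `H(0) ≤ I(0)/2K`, which is the claim. [cite: CarrilloNi2009, §3 (pp. 7–8)] -/
theorem logSobolev_of_heatFlow (hR : g.IsRiemannian) {V : M → ℝ} {K : ℝ} (hK : 0 < K)
    (hV : ContMDiff I 𝓘(ℝ, ℝ) ∞ V)
    (hRic : ∀ (y : M) (X : TangentSpace I y), K * g.val y X X ≤ g.ricci y X X + g.hessian V y X X)
    (hmass : ∫ x, Real.exp (-V x) ∂g.riemVolume = 1)
    (hflow : ∀ h₀ : M → ℝ, ContMDiff I 𝓘(ℝ, ℝ) ∞ h₀ → (∀ x, 0 < h₀ x) →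
      ∃ u : ℝ → M → ℝ,
        ContMDiffOn (I.prod 𝓘(ℝ, ℝ)) 𝓘(ℝ, ℝ) ∞ (fun p : M × ℝ ↦ u p.2 p.1) (univ ×ˢ Ici 0) ∧
        (∀ t ∈ Ici (0 : ℝ), ∀ x, 0 < u t x) ∧ u 0 = h₀ ∧
        (∀ t ∈ Ici (0 : ℝ), ∀ x, derivWithin (fun s ↦ u s x) (Ici 0) t =
          g.dalembertian (u t) x - g.innerDual x (mvfderiv I V x : TangentSpace I x →ₗ[ℝ] ℝ)
            (mvfderiv I (u t) x : TangentSpace I x →ₗ[ℝ] ℝ)) ∧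
        TendstoUniformly (fun t ↦ u t)
          (fun _ ↦ ∫ x, h₀ x * Real.exp (-V x) ∂g.riemVolume) Filter.atTop)
    (φ : M → ℝ) (hφ : ContMDiff I 𝓘(ℝ, ℝ) ∞ φ)
    (hφmass : ∫ x, Real.exp (φ x) * Real.exp (-V x) ∂g.riemVolume = 1) :
    ∫ x, φ x * (Real.exp (φ x) * Real.exp (-V x)) ∂g.riemVolume ≤
      1 / (2 * K) * ∫ x, g.gradSq φ x * (Real.exp (φ x) * Real.exp (-V x)) ∂g.riemVolume := by
  have hS : UniqueDiffOn ℝ (Ici (0 : ℝ)) := uniqueDiffOn_Ici 0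
  -- the flow from `h₀ = e^φ`
  obtain ⟨u, hu, hupos, hu0, hueq, hulim⟩ := hflow (fun x ↦ Real.exp (φ x))
    (Real.contDiff_exp.comp_contMDiff hφ) (fun x ↦ Real.exp_pos _)
  rw [hφmass] at hulim
  -- `f = −log u`
  set f : ℝ → M → ℝ := fun t y ↦ -Real.log (u t y) with hfdef
  have hf : ContMDiffOn (I.prod 𝓘(ℝ, ℝ)) 𝓘(ℝ, ℝ) ∞ (fun p : M × ℝ ↦ f p.2 p.1) (univ ×ˢ Ici 0) := by
    intro p hp
    have hne : u p.2 p.1 ≠ 0 := (hupos p.2 hp.2 p.1).ne'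
    exact ((Real.contDiffAt_log.2 hne).comp_contMDiffWithinAt
      (f := fun p : M × ℝ ↦ u p.2 p.1) (x := p) (hu p hp)).neg
  have hslice : ∀ t ∈ Ici (0 : ℝ), ContMDiff I 𝓘(ℝ, ℝ) ∞ (u t) := fun t ht ↦
    hu.comp_contMDiff (contMDiff_id.prodMk contMDiff_const) fun y ↦ ⟨mem_univ _, ht⟩
  have heq : ∀ t ∈ Ici (0 : ℝ), ∀ y : M, derivWithin (fun s ↦ f s y) (Ici 0) t =
      g.dalembertian (f t) y
        - g.innerDual y (mvfderiv I V y : TangentSpace I y →ₗ[ℝ] ℝ)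
            (mvfderiv I (f t) y : TangentSpace I y →ₗ[ℝ] ℝ)
        - g.gradSq (f t) y := by
    intro t ht y
    have hut : ContMDiffAt I 𝓘(ℝ, ℝ) 2 (u t) y :=
      ((hslice t ht).of_le (WithTop.coe_le_coe.mpr le_top)).contMDiffAt
    exact negLog_heat_equation g hut (hupos t ht y)
      (hasDerivWithinAt_time_of_contMDiffOn (k := ∞) (by simp) hu y ht) (hS t ht) (hueq t ht y)
  -- `H(t) → 0`
  have hlim : Filter.Tendsto
      (fun s ↦ ∫ y, (-f s y) * Real.exp (-f s y) * Real.exp (-V y) ∂g.riemVolume)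
      Filter.atTop (𝓝 0) := by
    have h := tendsto_entropy_of_tendstoUniformly g hV hmass
      (fun t ht ↦ (hslice t ht).continuous) hulim
    refine h.congr' ?_
    filter_upwards [Filter.eventually_ge_atTop (0 : ℝ)] with t ht
    refine integral_congr_ae (Filter.Eventually.of_forall fun y ↦ ?_)
    have hp : 0 < u t y := hupos t ht y
    simp only [hfdef, neg_neg, Real.exp_log hp]
    ring
  -- `H(0) ≤ I(0)/2K`
  have hmain := entropy_le_fisher_div g hR hK hV hRic hf heq hlim
  -- identify `f 0 = −φ`
  have hf0 : f 0 = fun y ↦ -φ y := by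
    funext y
    simp only [hfdef, hu0, Real.log_exp]
  have hq : ∀ y, g.gradSq (fun y ↦ -φ y) y = g.gradSq φ y := fun y ↦ g.gradSq_neg φ y
  rw [hf0] at hmain
  simp only [neg_neg, hq] at hmain
  have hl : ∫ x, φ x * (Real.exp (φ x) * Real.exp (-V x)) ∂g.riemVolume =
      ∫ x, φ x * Real.exp (φ x) * Real.exp (-V x) ∂g.riemVolume :=
    integral_congr_ae (Filter.Eventually.of_forall fun x ↦ by ring)
  have hr : ∫ x, g.gradSq φ x * (Real.exp (φ x) * Real.exp (-V x)) ∂g.riemVolume =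
      ∫ x, g.gradSq φ x * Real.exp (φ x) * Real.exp (-V x) ∂g.riemVolume :=
    integral_congr_ae (Filter.Eventually.of_forall fun x ↦ by ring)
  rw [hl, hr]
  exact hmain

end HeatFlow

/-! ### Carrillo–Ni's Cor. 4.1 (closed case) from the weighted heat flow -/

/-- **`carrilloNi_muEntropy_eq_log_shrinkerDensity` follows from the existence and long-time
behaviour of the weighted heat flow on closed weighted manifolds.** Hypothesis `hHeat` (the
weighted heat semigroup of a closed Riemannian manifold — e.g. A. Grigor'yan, *Heat kernel and
analysis on manifolds*, AMS/IP 2009, for weighted manifolds `(M, g, e^{-V}dV)`: Thm. 7.7–7.10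
(existence and smoothness of `P_t h₀` for smooth `h₀`, `t ≥ 0`), Thm. 7.16/8.? (positivity),
and the convergence `P_t h₀ → ∫ h₀ dm` on a compact connected weighted manifold of unit mass):
for `g` Riemannian on a closed connected manifold, `V` smooth with `∫ e^{-V} dV_g = 1` and `h₀`
smooth positive, there is `u` smooth on `M × [0, ∞)`, positive, with `u(0) = h₀`,
`∂ₜu = Δ_g u − g⁻¹(dV, du)` and `u(t, ·) → ∫ h₀ e^{-V} dV_g` uniformly. CONCLUSION: the named fact
(Carrillo–Ni 2009, Cor. 4.1, closed case). Proof: `carrilloNi_muEntropy_eq_log_shrinkerDensity_of_bakryEmery`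
with the Bakry–Émery inequality supplied by `logSobolev_of_heatFlow` (the Bakry–Émery strategy,
Carrillo–Ni §3, entirely proved in the tree: `CoordFisherDissipation.lean` and this file).
[cite: CarrilloNi2009, §3–§4 and Cor. 4.1] -/
theorem carrilloNi_muEntropy_eq_log_shrinkerDensity_of_heatFlow
    (hHeat : ∀ (E : Type u) [NormedAddCommGroup E] [NormedSpace ℝ E] [FiniteDimensional ℝ E]
      (H : Type u) [TopologicalSpace H] (I : ModelWithCorners ℝ E H) [I.Boundaryless]
      (M : Type u) [TopologicalSpace M] [ChartedSpace H M] [IsManifold I ∞ M] [T3Space M]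
      [MeasurableSpace M] [BorelSpace M] [CompactSpace M] [ConnectedSpace M]
      (g : PseudoRiemannianMetric I ∞ E (TangentSpace I : M → Type _)) [g.HasLeviCivita]
      (V : M → ℝ) (h₀ : M → ℝ), g.IsRiemannian → ContMDiff I 𝓘(ℝ, ℝ) ∞ V →
      ∫ x, Real.exp (-V x) ∂g.riemVolume = 1 →
      ContMDiff I 𝓘(ℝ, ℝ) ∞ h₀ → (∀ x, 0 < h₀ x) →
      ∃ u : ℝ → M → ℝ,
        ContMDiffOn (I.prod 𝓘(ℝ, ℝ)) 𝓘(ℝ, ℝ) ∞ (fun p : M × ℝ ↦ u p.2 p.1) (univ ×ˢ Ici 0) ∧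
        (∀ t ∈ Ici (0 : ℝ), ∀ x, 0 < u t x) ∧ u 0 = h₀ ∧
        (∀ t ∈ Ici (0 : ℝ), ∀ x, derivWithin (fun s ↦ u s x) (Ici 0) t =
          g.dalembertian (u t) x - g.innerDual x (mvfderiv I V x : TangentSpace I x →ₗ[ℝ] ℝ)
            (mvfderiv I (u t) x : TangentSpace I x →ₗ[ℝ] ℝ)) ∧
        TendstoUniformly (fun t ↦ u t)
          (fun _ ↦ ∫ x, h₀ x * Real.exp (-V x) ∂g.riemVolume) Filter.atTop) :
    carrilloNi_muEntropy_eq_log_shrinkerDensity.{u} :=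
  carrilloNi_muEntropy_eq_log_shrinkerDensity_of_bakryEmery
    fun E _ _ _ H _ I _ M _ _ _ _ _ _ _ _ g _ V _K hg hV hK hRic hmass φ hφ hφmass ↦
      logSobolev_of_heatFlow g hg hK hV hRic hmass
        (fun h₀ hh₀ hpos ↦ hHeat E H I M g V h₀ hg hV hmass hh₀ hpos) φ hφ hφmass

end Literature.Geometry.Riemannian

end
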